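import Literature.NumberTheory.Sieve.ChenSwitchedRemainder
import HarnessLib

/-!
# Chen's theorem, twin form: the remainder of the enlarged switched set (Nathanson Thm 10.6, step 2)

Topic `Literature/NumberTheory/Sieve`, family `parity`; companion of
`Literature.NumberTheory.Sieve.ChenTwinUpperB`, whose conditional `twin_sieveUpperB_of` reduces
estimate (C) `Literature.NumberTheory.Sieve.Chen.twin_sieveUpperB` to a cardinality bound (`hcard`, PROVED
in `ChenTwinUpperBCard.lean`) and a remainder bound (`hrem`) for the enlarged set of triples
`T̃(x, ε)` (`chenTriplesExt`). This file PROVES the remainder bound: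

* `Literature.NumberTheory.Sieve.Chen.chenRemainderExt_bound` — for `0 < ε ≤ 1`, `δ > 0`:
  `∃ C, ∀ᶠ x, R(x, ε, x^{1/2−δ}) ≤ C x/(log x)³` (with `C = 1`), where
  `R(x, ε, D) = ∑_{d < D, d ∣ P(y)} |#{t ∈ T̃ : d ∣ p₁p₂p₃ − 2} − g(d) #T̃|` (`chenRemainderExt`).

This is Nathanson, *Additive Number Theory: The Classical Bases* (GTM 164), (10.15)
(`R^{(ℓ)} ≪ N/(log N)⁴`, p. 176 of the held copy) summed over the `O(ε⁻¹ log N)` grid pieces, with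
its proof on pp. 181–182 from the **bilinear form inequality, Theorem 10.7** — PROVED in the tree in
explicit form as `Literature.NumberTheory.Sieve.Bilinear.primes_explicit` (`ChenBilinearForm.lean`: orthogonality,
primitive characters, the Siegel–Walfisz theorem `Literature.NumberTheory.LFunctions.siegel_walfisz_holds`
for the small conductors and the large sieve `LargeSieve.largeSieve_bilinear` for the large ones).

## The proof (Nathanson pp. 181–182, for `{p₁p₂p₃ − 2}` instead of `{N − p₁p₂p₃}`)

* The grid pieces (defs `gridLevel`, `chenPieceLo`, `chenPieceHi`, `chenPiecePrimes`,
  `chenPiecePairs`, `chenPieceNums`, `chenPieceLen`, `chenPieceCount`): the triples of grid index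
  `k` form the product `P_k × N_k` (`filter_chenTriplesExt_index_eq`), `P_k` = primes
  `ℓ_k ≤ p₁ < (1+ε)ℓ_k` in `[x^{1/8}, y)` (`chenGridIndex_eq_iff`, `ChenSwitchedRemainder.lean`), `N_k` = pairs `y ≤ p₂ ≤ p₃` with
  `ℓ_k p₂p₃ ≤ x + 2`, in bijection with the numbers `n = p₂p₃ ≤ M_k = ⌊(x+2)/ℓ_k⌋`
  (`mul_injOn_primePairs`); there are `K ≤ log x/(2 log(1+ε))` pieces (`chenPieceCount_le`).
* For odd `d ∣ P(y)` (even `d` contribute nothing: all `p₁p₂p₃ − 2` are odd), the congruence count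
  of a piece is the bilinear sum `∑_{n ≤ M_k} ∑_{p ∈ P_k} [np ≡ 2 (d)] a(n)` of Thm 10.7 with
  `a = 1_{N_k}` (`card_filter_dvd_piece_eq`), and replacing `#P_k #N_k` by the coprime count costs
  `≤ ω(d) #N_k` (`card_mul_card_sub_card_coprime_le`; Nathanson: "decreases the second term by at
  most … `≪ N log d/(zφ(d))`"); hence `remainder_term_le`:
  `|r_d| ≤ ∑_{k<K} (max_c ‖disc_k(d, c)‖ + ω(d) #N_k/φ(d))`.
* Thm 10.7 for each piece (`sum_iSup_piece_le`: `Bilinear.primes_explicit` with `K = 1`, `A₂ = 22`,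
  `D₀ = ⌊(log x)⁷⌋`, Siegel–Walfisz scale `(1+ε)ℓ_k`) and the uniform majorant `piece_explicit_le`
  in `u = x^{1/16}`; the corrections total `≤ K · 2x^{7/8} · (log D/log 2) · W(D)`,
  `W(D) = ∑_{d ≤ D} 1/φ(d) ≤ (1 + log D)²`; finally `(log x)^{21} ≤ x^{1/16}`, `(log x)⁷ ≤ x^δ` for large
  `x` (`eventually_log_rpow_le_rpow`) give `R ≤ x/(log x)³`. (Nathanson's level is
  `N^{1/2}(log N)^{−6}` and his saving `(log N)^{−4}` per piece; here the level is `x^{1/2−δ}`, as in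
  `ChenTwinUpperB.lean`, and all constants are explicit.)

## References

* M. B. Nathanson, *Additive Number Theory: The Classical Bases*, GTM 164 (1996), Thm 10.6 (proof,
  (10.12)–(10.15)), Thm 10.7 and pp. 181–182 of the held copy. [Nathanson1996]
* Chen Jing-run, Sci. Sinica 16 (1973), 157–176, p. 176 (the twin form). [ChenSciSinica1973]
-/

open Finset Filter Topology

noncomputable section

namespace Literature.NumberTheory.Sieve.Chen

/-! ### The grid pieces of `T̃(x, ε)` -/

/-- The lower cut-off of the `k`-th prime window: `max(⌈x^{1/8}⌉, ⌈ℓ_k⌉)`. [folklore] -/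
def chenPieceLo (x : ℕ) (ε : ℝ) (k : ℕ) : ℕ := max (twinZ x) ⌈gridLevel x ε k⌉₊

/-- The upper cut-off of the `k`-th prime window: `min(⌈(x+3)^{1/3}⌉, ⌈(1+ε)ℓ_k⌉)`. [folklore] -/
def chenPieceHi (x : ℕ) (ε : ℝ) (k : ℕ) : ℕ := min (twinY x) ⌈(1 + ε) * gridLevel x ε k⌉₊

/-- The primes `p₁` of the `k`-th grid piece: `ℓ_k ≤ p₁ < (1+ε)ℓ_k`, `x^{1/8} ≤ p₁ < (x+3)^{1/3}`
(Nathanson (10.13): `ℓ ≤ p₁ < (1+ε)ℓ`, `z ≤ p₁ < y`), written as the prime variable of Thm 10.7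
with `K = 1` (the conjunct `¬p ∣ 1` is vacuous for primes). [cite: Nathanson1996, Thm 10.6 (proof, (10.13))] -/
def chenPiecePrimes (x : ℕ) (ε : ℝ) (k : ℕ) : Finset ℕ :=
  (Nat.primesBelow (chenPieceHi x ε k)).filter fun p => chenPieceLo x ε k ≤ p ∧ ¬p ∣ 1

/-- The pairs `(p₂, p₃)` of the `k`-th grid piece: primes `y ≤ p₂ ≤ p₃` with `ℓ_k p₂p₃ ≤ x + 2`
(Nathanson (10.13): `y ≤ p₂ ≤ p₃`, `ℓ p₂p₃ < N`). [cite: Nathanson1996, Thm 10.6 (proof, (10.13))] -/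
def chenPiecePairs (x : ℕ) (ε : ℝ) (k : ℕ) : Finset (ℕ × ℕ) :=
  (Finset.range (2 * x + 5) ×ˢ Finset.range (2 * x + 5)).filter fun q : ℕ × ℕ =>
    q.1.Prime ∧ q.2.Prime ∧ twinY x ≤ q.1 ∧ q.1 ≤ q.2 ∧
      gridLevel x ε k * q.1 * q.2 ≤ (x : ℝ) + 2

/-- The numbers `n = p₂p₃` of the `k`-th grid piece (the support of Nathanson's `a(n)`, p. 181).
[cite: Nathanson1996, Thm 10.6 (proof, p. 181)] -/
def chenPieceNums (x : ℕ) (ε : ℝ) (k : ℕ) : Finset ℕ :=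
  (chenPiecePairs x ε k).image fun q : ℕ × ℕ => q.1 * q.2

/-- The length of the `n`-variable of the `k`-th piece: `M_k = ⌊(x+2)/ℓ_k⌋` (Nathanson: `X = N/ℓ`).
[cite: Nathanson1996, Thm 10.6 (proof, p. 181)] -/
def chenPieceLen (x : ℕ) (ε : ℝ) (k : ℕ) : ℕ := ⌊((x : ℝ) + 2) / gridLevel x ε k⌋₊

/-- Membership in the prime window. [folklore] -/
theorem mem_chenPiecePrimes {x : ℕ} {ε : ℝ} {k p : ℕ} (hx : 0 < x) (hε : 0 < ε) :
    p ∈ chenPiecePrimes x ε k ↔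
      p.Prime ∧ twinZ x ≤ p ∧ p < twinY x ∧ chenGridIndex x ε p = k := by
  rw [chenPiecePrimes, Finset.mem_filter, Nat.mem_primesBelow, chenPieceHi, chenPieceLo,
    lt_min_iff, max_le_iff, Nat.dvd_one]
  constructor
  · rintro ⟨⟨⟨hY, hup⟩, hprime⟩, ⟨hZ, hlo⟩, -⟩
    have hp : (x : ℝ) ^ (1 / 8 : ℝ) ≤ p := twinZ_le_iff.mp hZ
    refine ⟨hprime, hZ, hY, (chenGridIndex_eq_iff hx hε hp k).mpr ⟨Nat.ceil_le.mp hlo, ?_⟩⟩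
    exact Nat.lt_ceil.mp hup
  · rintro ⟨hprime, hZ, hY, hk⟩
    have hp : (x : ℝ) ^ (1 / 8 : ℝ) ≤ p := twinZ_le_iff.mp hZ
    obtain ⟨h1, h2⟩ := (chenGridIndex_eq_iff hx hε hp k).mp hk
    exact ⟨⟨⟨hY, Nat.lt_ceil.mpr h2⟩, hprime⟩, ⟨hZ, Nat.ceil_le.mpr h1⟩, hprime.ne_one⟩

/-- Membership in the set of pairs. [folklore] -/
theorem mem_chenPiecePairs {x : ℕ} {ε : ℝ} {k : ℕ} {q : ℕ × ℕ} :
    q ∈ chenPiecePairs x ε k ↔ (q.1 < 2 * x + 5 ∧ q.2 < 2 * x + 5) ∧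
      q.1.Prime ∧ q.2.Prime ∧ twinY x ≤ q.1 ∧ q.1 ≤ q.2 ∧
        gridLevel x ε k * q.1 * q.2 ≤ (x : ℝ) + 2 := by
  simp only [chenPiecePairs, Finset.mem_filter, Finset.mem_product, Finset.mem_range]

/-- `y(x) ≤ x + 4`. [folklore] -/
theorem twinY_le_add_four (x : ℕ) : twinY x ≤ x + 4 := by
  unfold twinY
  have h0 : (0 : ℝ) ≤ (x : ℝ) + 3 := by positivity
  have h1 : ((x : ℝ) + 3) ^ (1 / 3 : ℝ) ≤ (x : ℝ) + 3 := by
    have h2 : (1 : ℝ) ≤ (x : ℝ) + 3 := by linarith [show (0:ℝ) ≤ x from Nat.cast_nonneg x]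
    calc ((x : ℝ) + 3) ^ (1 / 3 : ℝ) ≤ ((x : ℝ) + 3) ^ (1 : ℝ) :=
          Real.rpow_le_rpow_of_exponent_le h2 (by norm_num)
      _ = (x : ℝ) + 3 := Real.rpow_one _
  have h3 : (⌈((x : ℝ) + 3) ^ (1 / 3 : ℝ)⌉₊ : ℝ) < (x : ℝ) + 3 + 1 :=
    (Nat.ceil_lt_add_one (Real.rpow_nonneg h0 _)).trans_le (by linarith)
  have : (⌈((x : ℝ) + 3) ^ (1 / 3 : ℝ)⌉₊ : ℝ) < ((x + 4 : ℕ) : ℝ) := by push_cast; linarith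
  exact_mod_cast this.le

/-- **`T̃(x, ε)` is the disjoint union of the product pieces**: the triples of grid index `k` are
exactly `P_k × N_k` (Nathanson: `B̃ = ⋃_ℓ B^{(ℓ)}` with `B^{(ℓ)}` a "bilinear form" in `p₁` and
`p₂p₃`, p. 175). [cite: Nathanson1996, Thm 10.6 (proof, (10.13))] -/
theorem filter_chenTriplesExt_index_eq {x : ℕ} {ε : ℝ} (hx : 0 < x) (hε : 0 < ε) (k : ℕ) :
    (chenTriplesExt x ε).filter (fun t : ℕ × ℕ × ℕ => chenGridIndex x ε t.1 = k) =
      chenPiecePrimes x ε k ×ˢ chenPiecePairs x ε k := by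
  ext t
  rw [Finset.mem_filter, mem_chenTriplesExt, Finset.mem_product, mem_chenPiecePrimes hx hε,
    mem_chenPiecePairs]
  constructor
  · rintro ⟨⟨⟨-, h2, h3⟩, hp1, hp2, hp3, hz, hy, hy', h23, hgrid⟩, hk⟩
    refine ⟨⟨hp1, hz, hy, hk⟩, ⟨h2, h3⟩, hp2, hp3, hy', h23, ?_⟩
    rwa [chenGridPoint_eq_gridLevel, hk] at hgrid
  · rintro ⟨⟨hp1, hz, hy, hk⟩, ⟨h2, h3⟩, hp2, hp3, hy', h23, hgrid⟩
    have hY := twinY_le_add_four x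
    refine ⟨⟨⟨by omega, h2, h3⟩, hp1, hp2, hp3, hz, hy, hy', h23, ?_⟩, hk⟩
    rwa [chenGridPoint_eq_gridLevel, hk]

/-- The pairs of a piece are ordered pairs of primes. [folklore] -/
theorem chenPiecePairs_prime_le (x : ℕ) (ε : ℝ) (k : ℕ) :
    ∀ q ∈ chenPiecePairs x ε k, q.1.Prime ∧ q.2.Prime ∧ q.1 ≤ q.2 := fun q hq => by
  obtain ⟨-, h1, h2, -, h12, -⟩ := mem_chenPiecePairs.mp hq
  exact ⟨h1, h2, h12⟩

/-- `#N_k = #(pairs)`. [folklore] -/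
theorem card_chenPieceNums (x : ℕ) (ε : ℝ) (k : ℕ) :
    #(chenPieceNums x ε k) = #(chenPiecePairs x ε k) :=
  Finset.card_image_of_injOn (mul_injOn_primePairs _ (chenPiecePairs_prime_le x ε k))

/-- The numbers of a piece lie in `(0, M_k]`. [folklore] -/
theorem chenPieceNums_subset_Ioc {x : ℕ} {ε : ℝ} (hx : 0 < x) (hε : 0 < ε) (k : ℕ) :
    chenPieceNums x ε k ⊆ Finset.Ioc 0 (chenPieceLen x ε k) := by
  intro n hn
  rw [chenPieceNums, Finset.mem_image] at hn
  obtain ⟨q, hq, rfl⟩ := hn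
  obtain ⟨-, hp2, hp3, -, -, hle⟩ := mem_chenPiecePairs.mp hq
  have hℓ := (gridLevel_pos hx hε k).1
  rw [Finset.mem_Ioc]
  refine ⟨Nat.mul_pos hp2.pos hp3.pos, Nat.le_floor ?_⟩
  rw [le_div_iff₀ hℓ]
  push_cast
  nlinarith

/-- The numbers of a piece are coprime to every `d ∣ P(y)` (their prime factors are `≥ y`).
[cite: Nathanson1996, Thm 10.6 (proof, p. 181)] -/
theorem coprime_of_mem_chenPieceNums {x : ℕ} {ε : ℝ} {k n d : ℕ} (hn : n ∈ chenPieceNums x ε k)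
    (hd : d ∣ primesProdBelow (twinY x : ℝ)) : n.Coprime d := by
  rw [chenPieceNums, Finset.mem_image] at hn
  obtain ⟨q, hq, rfl⟩ := hn
  obtain ⟨-, hp2, hp3, hy, h23, -⟩ := mem_chenPiecePairs.mp hq
  have hd0 : d ≠ 0 := fun h => primesProdBelow_ne_zero _ (zero_dvd_iff.mp (h ▸ hd))
  have key : ∀ p : ℕ, p.Prime → twinY x ≤ p → p.Coprime d := by
    intro p hp hyp
    rw [Nat.Prime.coprime_iff_not_dvd hp]
    intro hpd
    have hpP : p ∣ primesProdBelow (twinY x : ℝ) := hpd.trans hd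
    rw [dvd_primesProdBelow_iff hp] at hpP
    have : (p : ℝ) < twinY x := hpP
    exact absurd (by exact_mod_cast hyp) (not_le.mpr this)
  exact Nat.Coprime.mul_left (key q.1 hp2 hy) (key q.2 hp3 (hy.trans h23))

/-! ### The counts of a piece as bilinear sums (the left side of Thm 10.7) -/

/-- The coefficient `a(n) = 1` if `n = p₂p₃` is a number of the `k`-th piece, `0` otherwise
(Nathanson p. 181: "Let `a(n)` be the characteristic function of the set of numbers of the form
`n = p₂p₃`"). We use it inline as `fun n => if n ∈ chenPieceNums x ε k then 1 else 0`. [folklore] -/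
theorem norm_indicator_le_one (S : Finset ℕ) (n : ℕ) :
    ‖(if n ∈ S then (1 : ℂ) else 0)‖ ≤ 1 := by
  split_ifs <;> simp

/-- `d ∣ pn − 2 ⟺ pn ≡ 2 (mod d)` in `ZMod d`, for `pn ≥ 2`. [folklore] -/
theorem dvd_sub_two_iff_cast_eq {d m : ℕ} (hm : 2 ≤ m) :
    d ∣ m - 2 ↔ ((m : ℕ) : ZMod d) = ((2 : ℕ) : ZMod d) := by
  rw [ZMod.natCast_eq_natCast_iff, Nat.ModEq.comm, Nat.modEq_iff_dvd' hm]

/-- **The congruence count of a piece as a bilinear sum** (Nathanson p. 181: `r_d^{(ℓ)}` written with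
`a(n)`): for `(2, d) = 1` and `c = 2 mod d`,
`#{(p₁, (p₂,p₃)) ∈ P_k × N_k : d ∣ p₁p₂p₃ − 2} = ∑_{n ≤ M_k} ∑_{p ∈ P_k} [np ≡ c (d)] a(n)`.
[cite: Nathanson1996, Thm 10.6 (proof, p. 181)] -/
theorem card_filter_dvd_piece_eq {x : ℕ} {ε : ℝ} (hx : 0 < x) (hε : 0 < ε) (k : ℕ) {d : ℕ}
    (hd : Nat.Coprime 2 d) :
    ((#((chenPiecePrimes x ε k ×ˢ chenPiecePairs x ε k).filter
        fun t : ℕ × ℕ × ℕ => d ∣ t.1 * t.2.1 * t.2.2 - 2) : ℕ) : ℂ) =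
      ∑ n ∈ Finset.Ioc 0 (chenPieceLen x ε k), ∑ p ∈ chenPiecePrimes x ε k,
        (if ((n * p : ℕ) : ZMod d) = ((ZMod.unitOfCoprime 2 hd : (ZMod d)ˣ) : ZMod d) then
          (if n ∈ chenPieceNums x ε k then (1 : ℂ) else 0) else 0) := by
  classical
  set Pk := chenPiecePrimes x ε k with hPk
  set Qk := chenPiecePairs x ε k with hQk
  set Nk := chenPieceNums x ε k with hNk
  rw [ZMod.coe_unitOfCoprime]
  -- the count as a sum of indicators over `P_k × pairs`
  rw [Finset.natCast_card_filter, Finset.sum_product]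
  -- reindex the pairs by their product
  have hinner : ∀ p ∈ Pk, (∑ q ∈ Qk, if d ∣ p * q.1 * q.2 - 2 then (1 : ℂ) else 0) =
      ∑ n ∈ Nk, if ((n * p : ℕ) : ZMod d) = ((2 : ℕ) : ZMod d) then (1 : ℂ) else 0 := by
    intro p hp
    have hp2 : 2 ≤ p := ((mem_chenPiecePrimes hx hε).mp hp).1.two_le
    rw [hNk, chenPieceNums, Finset.sum_image (mul_injOn_primePairs _ (chenPiecePairs_prime_le x ε k))]
    refine Finset.sum_congr rfl fun q hq => ?_
    obtain ⟨-, hq1, hq2, -⟩ := mem_chenPiecePairs.mp hq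
    have hm : 2 ≤ p * q.1 * q.2 := by
      have := hq1.two_le; have := hq2.two_le
      calc 2 ≤ 2 * 1 * 1 := by norm_num
        _ ≤ p * q.1 * q.2 := by gcongr <;> omega
    have : q.1 * q.2 * p = p * q.1 * q.2 := by ring
    rw [this]
    by_cases h : d ∣ p * q.1 * q.2 - 2
    · rw [if_pos h, if_pos ((dvd_sub_two_iff_cast_eq hm).mp h)]
    · rw [if_neg h, if_neg (mt (dvd_sub_two_iff_cast_eq hm).mpr h)]
  rw [Finset.sum_congr rfl hinner, Finset.sum_comm]
  -- extend the `n`-range from `N_k` to `(0, M_k]`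
  symm
  refine (Finset.sum_subset (chenPieceNums_subset_Ioc hx hε k) fun n _ hn => ?_).symm.trans ?_
  · refine Finset.sum_eq_zero fun p _ => ?_
    rw [if_neg hn]
    split_ifs <;> rfl
  · refine Finset.sum_congr rfl fun n hn => Finset.sum_congr rfl fun p _ => ?_
    rw [if_pos hn]

/-- **The coprime count of a piece as a bilinear sum**:
`#{(p, n) ∈ P_k × N_k : (pn, d) = 1} = ∑_{n ≤ M_k} ∑_{p ∈ P_k} [(np, d) = 1] a(n)`. [folklore] -/
theorem card_filter_coprime_piece_eq {x : ℕ} {ε : ℝ} (hx : 0 < x) (hε : 0 < ε) (k d : ℕ) :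
    ((#((chenPiecePrimes x ε k ×ˢ chenPieceNums x ε k).filter
        fun r : ℕ × ℕ => (r.1 * r.2).Coprime d) : ℕ) : ℂ) =
      ∑ n ∈ Finset.Ioc 0 (chenPieceLen x ε k), ∑ p ∈ chenPiecePrimes x ε k,
        (if (n * p).Coprime d then (if n ∈ chenPieceNums x ε k then (1 : ℂ) else 0) else 0) := by
  classical
  rw [Finset.natCast_card_filter, Finset.sum_product, Finset.sum_comm]
  symm
  refine (Finset.sum_subset (chenPieceNums_subset_Ioc hx hε k) fun n _ hn => ?_).symm.trans ?_
  · refine Finset.sum_eq_zero fun p _ => ?_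
    rw [if_neg hn]
    split_ifs <;> rfl
  · refine Finset.sum_congr rfl fun n hn => Finset.sum_congr rfl fun p _ => ?_
    rw [if_pos hn, mul_comm]

/-- **The coprimality correction** (Nathanson p. 181: "This additional condition decreases the
second term by at most … `≪ N log d/(zφ(d))`"): if every number of the piece is coprime to `d ≠ 0`,
then `#P_k · #N_k − #{(p, n) : (pn, d) = 1} ≤ ω(d) · #N_k`. [cite: Nathanson1996, Thm 10.6 (proof, p. 181)] -/
theorem card_mul_card_sub_card_coprime_le {x : ℕ} {ε : ℝ} (hx : 0 < x) (hε : 0 < ε) (k : ℕ) {d : ℕ}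
    (hd0 : d ≠ 0) (hcop : ∀ n ∈ chenPieceNums x ε k, n.Coprime d) :
    (#(chenPiecePrimes x ε k) * #(chenPieceNums x ε k) : ℝ) -
        #((chenPiecePrimes x ε k ×ˢ chenPieceNums x ε k).filter
          fun r : ℕ × ℕ => (r.1 * r.2).Coprime d) ≤
      d.primeFactors.card * #(chenPieceNums x ε k) := by
  classical
  set Pk := chenPiecePrimes x ε k with hPk
  set Nk := chenPieceNums x ε k with hNk
  have hsplit := Finset.card_filter_add_card_filter_not
    (s := Pk ×ˢ Nk) (fun r : ℕ × ℕ => (r.1 * r.2).Coprime d)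
  rw [Finset.card_product] at hsplit
  -- the non-coprime pairs are `{p ∈ P_k : p ∣ d} × N_k`
  have hbad : #((Pk ×ˢ Nk).filter fun r : ℕ × ℕ => ¬(r.1 * r.2).Coprime d) ≤
      d.primeFactors.card * #Nk := by
    have hsub : (Pk ×ˢ Nk).filter (fun r : ℕ × ℕ => ¬(r.1 * r.2).Coprime d) ⊆
        d.primeFactors ×ˢ Nk := by
      intro r hr
      rw [Finset.mem_filter, Finset.mem_product] at hr
      obtain ⟨⟨hp, hn⟩, hnc⟩ := hr
      have hprime : r.1.Prime := ((mem_chenPiecePrimes hx hε).mp hp).1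
      rw [Finset.mem_product, Nat.mem_primeFactors]
      refine ⟨⟨hprime, ?_, hd0⟩, hn⟩
      have h1 : ¬r.1.Coprime d := fun h => hnc (Nat.Coprime.mul_left h (hcop _ hn))
      exact (Nat.Prime.dvd_iff_not_coprime hprime).mpr h1
    calc #((Pk ×ˢ Nk).filter fun r : ℕ × ℕ => ¬(r.1 * r.2).Coprime d)
        ≤ #(d.primeFactors ×ˢ Nk) := Finset.card_le_card hsub
      _ = d.primeFactors.card * #Nk := Finset.card_product _ _
  have h : ((#Pk * #Nk : ℕ) : ℝ) - #((Pk ×ˢ Nk).filter fun r : ℕ × ℕ => (r.1 * r.2).Coprime d) =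
      #((Pk ×ˢ Nk).filter fun r : ℕ × ℕ => ¬(r.1 * r.2).Coprime d) := by
    rw [← hsplit]; push_cast; ring
  push_cast at h
  rw [h]
  exact_mod_cast hbad

/-! ### The remainder of one modulus -/

/-- The number of grid pieces: `K = ⌊log(y/x^{1/8})/log(1+ε)⌋ + 1` (Nathanson (10.12):
`0 ≤ k ≤ log(y/z)/log(1+ε)`). [cite: Nathanson1996, Thm 10.6 (proof, (10.12))] -/
def chenPieceCount (x : ℕ) (ε : ℝ) : ℕ :=
  ⌊Real.log ((twinY x : ℝ) / (x : ℝ) ^ (1 / 8 : ℝ)) / Real.log (1 + ε)⌋₊ + 1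

/-- Every triple of `T̃(x, ε)` has grid index `< K`. [cite: Nathanson1996, Thm 10.6 (proof, (10.12))] -/
theorem chenGridIndex_lt_chenPieceCount {x : ℕ} {ε : ℝ} (hx : 0 < x) (hε : 0 < ε)
    {t : ℕ × ℕ × ℕ} (ht : t ∈ chenTriplesExt x ε) :
    chenGridIndex x ε t.1 < chenPieceCount x ε := by
  obtain ⟨-, h₁, -, -, hz, hy, -⟩ := mem_chenTriplesExt.mp ht
  unfold chenGridIndex chenPieceCount
  have hx0 : (0 : ℝ) < x := by exact_mod_cast hx
  have hz0 : 0 < (x : ℝ) ^ (1 / 8 : ℝ) := Real.rpow_pos_of_pos hx0 _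
  have hp : (x : ℝ) ^ (1 / 8 : ℝ) ≤ t.1 := twinZ_le_iff.mp hz
  have hp0 : (0 : ℝ) < t.1 := hz0.trans_le hp
  have hlog1 : 0 < Real.log (1 + ε) := Real.log_pos (by linarith)
  have hY : (t.1 : ℝ) < twinY x := by exact_mod_cast hy
  refine Nat.lt_succ_of_le (Nat.floor_le_floor ?_)
  refine div_le_div_of_nonneg_right (Real.log_le_log (div_pos hp0 hz0) ?_) hlog1.le
  exact div_le_div_of_nonneg_right hY.le hz0.le

/-- **Counting over `T̃` piece by piece**: for every predicate `Q`,
`#{t ∈ T̃ : Q t} = ∑_{k < K} #{t ∈ P_k × N_k : Q t}`. [folklore] -/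
theorem card_filter_chenTriplesExt_eq_sum {x : ℕ} {ε : ℝ} (hx : 0 < x) (hε : 0 < ε)
    (Q : ℕ × ℕ × ℕ → Prop) [DecidablePred Q] :
    #((chenTriplesExt x ε).filter Q) =
      ∑ k ∈ Finset.range (chenPieceCount x ε),
        #((chenPiecePrimes x ε k ×ˢ chenPiecePairs x ε k).filter Q) := by
  classical
  rw [Finset.card_eq_sum_card_fiberwise (f := fun t : ℕ × ℕ × ℕ => chenGridIndex x ε t.1)
    (t := Finset.range (chenPieceCount x ε)) fun t ht => ?_]
  · refine Finset.sum_congr rfl fun k _ => ?_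
    rw [← filter_chenTriplesExt_index_eq hx hε k, Finset.filter_filter, Finset.filter_filter]
    congr 1
    ext t
    simp only [Finset.mem_filter]
    tauto
  · have ht' : t ∈ (chenTriplesExt x ε).filter Q := ht
    exact Finset.mem_coe.mpr (Finset.mem_range.mpr
      (chenGridIndex_lt_chenPieceCount hx hε (Finset.mem_filter.mp ht').1))

/-- `#T̃ = ∑_{k < K} #P_k · #N_k`. [folklore] -/
theorem card_chenTriplesExt_eq_sum {x : ℕ} {ε : ℝ} (hx : 0 < x) (hε : 0 < ε) :
    #(chenTriplesExt x ε) =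
      ∑ k ∈ Finset.range (chenPieceCount x ε), #(chenPiecePrimes x ε k) * #(chenPieceNums x ε k) := by
  classical
  have h := card_filter_chenTriplesExt_eq_sum hx hε (fun _ => True)
  rw [Finset.filter_true_of_mem fun _ _ => trivial] at h
  rw [h]
  refine Finset.sum_congr rfl fun k _ => ?_
  rw [Finset.filter_true_of_mem fun _ _ => trivial, Finset.card_product, card_chenPieceNums]

/-- `x^{1/8} ≥ 3` for `x ≥ 3⁸`, hence `3 ≤ twinZ x`. [folklore] -/
theorem three_le_twinZ {x : ℕ} (hx : 6561 ≤ x) : 3 ≤ twinZ x := by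
  have h : (3 : ℝ) ≤ (x : ℝ) ^ (1 / 8 : ℝ) := by
    rw [show (3 : ℝ) = ((3 : ℝ) ^ (8 : ℕ)) ^ (1 / 8 : ℝ) by
      rw [← Real.rpow_natCast, ← Real.rpow_mul (by norm_num)]; norm_num]
    exact Real.rpow_le_rpow (by norm_num) (by exact_mod_cast hx) (by norm_num)
  have : ((3 : ℕ) : ℝ) ≤ (twinZ x : ℝ) := by
    push_cast
    exact h.trans (Nat.le_ceil _)
  exact_mod_cast this

/-- For `t ∈ T̃(x, ε)` with `twinZ x ≥ 3`, `p₁p₂p₃ − 2` is odd. [folklore] -/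
theorem odd_prod_sub_two_of_mem {x : ℕ} {ε : ℝ} (h3 : 3 ≤ twinZ x) {t : ℕ × ℕ × ℕ}
    (ht : t ∈ chenTriplesExt x ε) : Odd (t.1 * t.2.1 * t.2.2 - 2) := by
  obtain ⟨-, h₁, h₂, h₃, hz, hy, hy', h23, -⟩ := mem_chenTriplesExt.mp ht
  have hodd : ∀ p : ℕ, p.Prime → 3 ≤ p → Odd p := fun p hp hp3 =>
    hp.odd_of_ne_two (by omega)
  have o₁ := hodd t.1 h₁ (h3.trans hz)
  have o₂ := hodd t.2.1 h₂ (by omega)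
  have o₃ := hodd t.2.2 h₃ (by omega)
  have hprod : Odd (t.1 * t.2.1 * t.2.2) := (o₁.mul o₂).mul o₃
  have h8 : 3 ≤ t.1 * t.2.1 * t.2.2 := by
    have a := h₁.two_le; have b := h₂.two_le; have c := h₃.two_le
    calc 3 ≤ 2 * 2 * 2 := by norm_num
      _ ≤ t.1 * t.2.1 * t.2.2 := by gcongr
  obtain ⟨m, hm⟩ := hprod
  exact ⟨m - 1, by omega⟩

/-- **The remainder of one modulus** (Nathanson (10.15): `|r_d| ≤ ∑_ℓ |r_d^{(ℓ)}|`, and p. 181: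
`r_d^{(ℓ)} = [bilinear discrepancy] + O(N log d/(zφ(d)))`): for `d ∣ P(y)`, `d ≠ 0`,
`|#{t ∈ T̃ : d ∣ p₁p₂p₃ − 2} − g(d) #T̃| ≤ ∑_{k<K} (max_c ‖disc_k(d, c)‖ + ω(d) #N_k/φ(d))`,
where `disc_k(d, c)` is the bilinear discrepancy of Thm 10.7 for the piece `k` with `a = 1_{N_k}`
(for even `d` both sides of the difference vanish). [cite: Nathanson1996, Thm 10.6 (proof, (10.15) and p. 181)] -/
theorem remainder_term_le {x : ℕ} {ε : ℝ} (hx : 0 < x) (hε : 0 < ε) (h3 : 3 ≤ twinZ x) {d : ℕ}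
    (hd0 : d ≠ 0) (hdP : d ∣ primesProdBelow (twinY x : ℝ)) :
    |(#((chenTriplesExt x ε).filter fun t : ℕ × ℕ × ℕ => d ∣ t.1 * t.2.1 * t.2.2 - 2) : ℝ) -
        shiftedPrimesDensity 2 d * #(chenTriplesExt x ε)| ≤
      ∑ k ∈ Finset.range (chenPieceCount x ε),
        ((⨆ c : (ZMod d)ˣ,
            ‖(∑ n ∈ Finset.Ioc 0 (chenPieceLen x ε k), ∑ p ∈ chenPiecePrimes x ε k,
                if ((n * p : ℕ) : ZMod d) = c then
                  (if n ∈ chenPieceNums x ε k then (1 : ℂ) else 0) else 0) -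
              ((Nat.totient d : ℂ))⁻¹ *
                ∑ n ∈ Finset.Ioc 0 (chenPieceLen x ε k), ∑ p ∈ chenPiecePrimes x ε k,
                  (if (n * p).Coprime d then
                    (if n ∈ chenPieceNums x ε k then (1 : ℂ) else 0) else 0)‖) +
          (d.primeFactors.card : ℝ) * #(chenPieceNums x ε k) / Nat.totient d) := by
  classical
  haveI : NeZero d := ⟨hd0⟩
  -- abbreviations
  set Kc := chenPieceCount x ε with hKc
  set A : ℕ → ℕ := fun k => #((chenPiecePrimes x ε k ×ˢ chenPiecePairs x ε k).filter
    fun t : ℕ × ℕ × ℕ => d ∣ t.1 * t.2.1 * t.2.2 - 2) with hA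
  set B : ℕ → ℕ := fun k => #((chenPiecePrimes x ε k ×ˢ chenPieceNums x ε k).filter
    fun r : ℕ × ℕ => (r.1 * r.2).Coprime d) with hB
  set PN : ℕ → ℕ := fun k => #(chenPiecePrimes x ε k) * #(chenPieceNums x ε k) with hPN
  set disc : ℕ → (ZMod d)ˣ → ℂ := fun k c =>
    (∑ n ∈ Finset.Ioc 0 (chenPieceLen x ε k), ∑ p ∈ chenPiecePrimes x ε k,
        if ((n * p : ℕ) : ZMod d) = c then (if n ∈ chenPieceNums x ε k then (1 : ℂ) else 0) else 0) -
      ((Nat.totient d : ℂ))⁻¹ *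
        ∑ n ∈ Finset.Ioc 0 (chenPieceLen x ε k), ∑ p ∈ chenPiecePrimes x ε k,
          (if (n * p).Coprime d then (if n ∈ chenPieceNums x ε k then (1 : ℂ) else 0) else 0)
    with hdisc
  have hsup0 : ∀ k, 0 ≤ ⨆ c : (ZMod d)ˣ, ‖disc k c‖ := fun k => Real.iSup_nonneg fun c => norm_nonneg _
  have hRHS0 : ∀ k, 0 ≤ (⨆ c : (ZMod d)ˣ, ‖disc k c‖) +
      (d.primeFactors.card : ℝ) * #(chenPieceNums x ε k) / Nat.totient d := fun k =>
    add_nonneg (hsup0 k) (by positivity)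
  show _ ≤ ∑ k ∈ Finset.range Kc, ((⨆ c : (ZMod d)ˣ, ‖disc k c‖) +
      (d.primeFactors.card : ℝ) * #(chenPieceNums x ε k) / Nat.totient d)
  rcases Nat.even_or_odd d with heven | hodd
  · -- even `d`: both terms vanish
    have hzero : #((chenTriplesExt x ε).filter fun t : ℕ × ℕ × ℕ => d ∣ t.1 * t.2.1 * t.2.2 - 2) = 0 := by
      rw [Finset.card_eq_zero, Finset.filter_eq_empty_iff]
      intro t ht hdvd
      have hodd := odd_prod_sub_two_of_mem h3 ht
      exact (Nat.not_even_iff_odd.mpr hodd) ((even_iff_two_dvd.mp heven).trans hdvd |> even_iff_two_dvd.mpr)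
    rw [hzero, shiftedPrimesDensity_two_of_even heven]
    simp only [Nat.cast_zero, zero_mul, sub_zero, abs_zero]
    exact Finset.sum_nonneg fun k _ => hRHS0 k
  -- odd `d`
  have hcop2 : Nat.Coprime 2 d := Nat.coprime_two_left.mpr hodd
  set c₂ : (ZMod d)ˣ := ZMod.unitOfCoprime 2 hcop2 with hc₂
  have hφ0 : (0 : ℝ) < Nat.totient d := by exact_mod_cast Nat.totient_pos.mpr (Nat.pos_of_ne_zero hd0)
  rw [shiftedPrimesDensity_two_odd hodd, card_filter_chenTriplesExt_eq_sum hx hε,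
    card_chenTriplesExt_eq_sum hx hε]
  push_cast
  -- `|∑_k A_k − φ⁻¹ ∑_k P_k N_k| ≤ ∑_k |A_k − φ⁻¹ P_k N_k|`
  have hcomb : (∑ k ∈ Finset.range Kc, (A k : ℝ)) -
      ((Nat.totient d : ℝ))⁻¹ * ∑ k ∈ Finset.range Kc, ((#(chenPiecePrimes x ε k) : ℝ) * #(chenPieceNums x ε k)) =
      ∑ k ∈ Finset.range Kc, ((A k : ℝ) - ((Nat.totient d : ℝ))⁻¹ * PN k) := by
    rw [Finset.mul_sum, ← Finset.sum_sub_distrib]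
    refine Finset.sum_congr rfl fun k _ => ?_
    rw [hPN]; push_cast; ring
  have hcomb' : (∑ x_1 ∈ Finset.range Kc, ((#({t ∈ chenPiecePrimes x ε x_1 ×ˢ chenPiecePairs x ε x_1 |
      d ∣ t.1 * t.2.1 * t.2.2 - 2}) : ℕ) : ℝ)) = ∑ k ∈ Finset.range Kc, (A k : ℝ) := rfl
  rw [hcomb', hcomb]
  refine (Finset.abs_sum_le_sum_abs _ _).trans (Finset.sum_le_sum fun k _ => ?_)
  -- one piece
  have hNcop : ∀ n ∈ chenPieceNums x ε k, n.Coprime d := fun n hn =>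
    coprime_of_mem_chenPieceNums hn hdP
  have hcorr := card_mul_card_sub_card_coprime_le hx hε k hd0 hNcop
  have hBle : (B k : ℝ) ≤ PN k := by
    rw [hB, hPN]
    exact_mod_cast (Finset.card_filter_le _ _).trans (Finset.card_product _ _).le
  -- the bilinear discrepancy at `c = 2`
  have hAeq := card_filter_dvd_piece_eq hx hε k hcop2
  have hBeq := card_filter_coprime_piece_eq hx hε k d
  have hdiscnorm : ‖disc k c₂‖ = |(A k : ℝ) - ((Nat.totient d : ℝ))⁻¹ * B k| := by
    have : disc k c₂ = (((A k : ℝ) - ((Nat.totient d : ℝ))⁻¹ * B k : ℝ) : ℂ) := by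
      rw [hdisc]
      simp only
      rw [← hAeq, ← hBeq]
      push_cast
      ring
    rw [this, Complex.norm_real, Real.norm_eq_abs]
  have hle_sup : ‖disc k c₂‖ ≤ ⨆ c : (ZMod d)ˣ, ‖disc k c‖ :=
    le_ciSup (f := fun c : (ZMod d)ˣ => ‖disc k c‖) (Set.finite_range _).bddAbove c₂
  -- combine
  have hPN' : (PN k : ℝ) = #(chenPiecePrimes x ε k) * #(chenPieceNums x ε k) := by
    rw [hPN]; push_cast; ring
  calc |(A k : ℝ) - ((Nat.totient d : ℝ))⁻¹ * PN k|
      = |((A k : ℝ) - ((Nat.totient d : ℝ))⁻¹ * B k) -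
          ((Nat.totient d : ℝ))⁻¹ * ((PN k : ℝ) - B k)| := by ring_nf
    _ ≤ |(A k : ℝ) - ((Nat.totient d : ℝ))⁻¹ * B k| + |((Nat.totient d : ℝ))⁻¹ * ((PN k : ℝ) - B k)| :=
        abs_sub _ _
    _ ≤ (⨆ c : (ZMod d)ˣ, ‖disc k c‖) +
          (d.primeFactors.card : ℝ) * #(chenPieceNums x ε k) / Nat.totient d := by
        refine add_le_add (hdiscnorm ▸ hle_sup) ?_
        rw [abs_of_nonneg (mul_nonneg (inv_nonneg.mpr hφ0.le) (by linarith)), div_eq_inv_mul]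
        refine mul_le_mul_of_nonneg_left ?_ (inv_nonneg.mpr hφ0.le)
        rw [hPN'] 
        exact hcorr

/-! ### A uniform majorant for the explicit bound of Thm 10.7 on one piece -/

set_option maxHeartbeats 800000 in
/-- **Bookkeeping for one piece** (Nathanson p. 182: "`≪ XY(log XY)²/(log Y)^A + N log D*/z ∑ 1/φ(d)
≪ N/(log N)^4`", here with every constant explicit). In the variable `u = x^{1/16}` (so `x = u¹⁶`,
`z = x^{1/8} = u²`, `x^{1/2} = u⁸`), for a piece with level `ℓ ∈ [u², u⁸]`, `n`-length
`M ≤ (x+2)/ℓ`, prime window of length `T' + 1 ≤ 4ℓ`, level of distribution `Dn ≤ Dx + 1`,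
`D₀ ∈ [L⁷/2, L⁷]`, Siegel–Walfisz scale `ℓ ≤ Y ≤ 2ℓ` with `log Y ≥ L/8`, `log(Y+1) ≤ L`,
`log Dn ≤ L` (`L = log x ≥ 2`) and `W ≤ 4L²`, the explicit bound of `Bilinear.primes_explicit`
(`K = 1`, `A₂ = 22`) is at most
`4L² ((60/log 2) L¹⁴ u¹⁵ + (C₂ 2⁹¹/log 2) u¹⁶/L⁸ + 32 u¹⁶/L⁷ + 24 L u¹⁵ + 32 u⁸ (Dx + 1))`.
[cite: Nathanson1996, Thm 10.6 (proof, p. 182)] -/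
theorem piece_explicit_le {u L ℓ M T' Dn Dx D₀ Y C₂ W : ℝ} (hu : 2 ≤ u) (hL : 2 ≤ L)
    (hℓlo : u ^ 2 ≤ ℓ) (hℓhi : ℓ ≤ u ^ 8) (hM0 : 0 ≤ M) (hM : M ≤ (u ^ 16 + 2) / ℓ)
    (hT0 : 0 ≤ T') (hT : T' + 1 ≤ 4 * ℓ) (hDn1 : 1 ≤ Dn) (hDn : Dn ≤ Dx + 1) (hDx : 0 ≤ Dx)
    (hlogDn : Real.log Dn ≤ L) (hD₀lo : L ^ 7 / 2 ≤ D₀) (hD₀hi : D₀ ≤ L ^ 7) (hYlo : ℓ ≤ Y)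
    (hYhi : Y ≤ 2 * ℓ) (hlogY : L / 8 ≤ Real.log Y) (hlogY1 : Real.log (Y + 1) ≤ L)
    (hC₂ : 0 ≤ C₂) (hW : W ≤ 4 * L ^ 2) :
    W * (D₀ * M *
          (2 * (D₀ * (7 * Real.sqrt Y + C₂ * (2 : ℝ) ^ (22 : ℝ) * Y / Real.log Y ^ (22 : ℝ)) / Real.log 2 +
              2 * Real.sqrt (Y + 1) * Real.log (Y + 1) / Real.log 2) +
            Real.log 1 / Real.log 2 + Real.log Dn / Real.log 2) +
        (2 * (M + 1) * (T' + 1) / D₀ +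
          2 * (Real.sqrt M * (T' + 1) + Real.sqrt T' * (M + 1)) * (2 + Real.log Dn) +
            8 * Real.sqrt (M * T') * Dn)) ≤
      4 * L ^ 2 * (60 / Real.log 2 * L ^ 14 * u ^ 15 + C₂ * 2 ^ 91 / Real.log 2 * u ^ 16 / L ^ 8 +
        32 * u ^ 16 / L ^ 7 + 24 * L * u ^ 15 + 32 * u ^ 8 * (Dx + 1)) := by
  -- basic positivity
  have hu0 : 0 < u := by linarith
  have hu1 : 1 ≤ u := by linarith
  have hL0 : 0 < L := by linarith
  have hL1 : 1 ≤ L := by linarith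
  have hℓ0 : 0 < ℓ := lt_of_lt_of_le (by positivity) hℓlo
  have hY0 : 0 < Y := hℓ0.trans_le hYlo
  have hlog2 : 0 < Real.log 2 := Real.log_pos one_lt_two
  have hlogY0 : 0 < Real.log Y := lt_of_lt_of_le (by positivity) hlogY
  have hD₀0 : 0 < D₀ := lt_of_lt_of_le (by positivity) hD₀lo
  have hlogDn0 : 0 ≤ Real.log Dn := Real.log_nonneg hDn1
  have hDn0 : 0 ≤ Dn := by linarith
  have hu4 : (4 : ℝ) ≤ u ^ 2 := by nlinarith only [hu]
  set I : ℝ := u ^ 16 + 2 with hI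
  have hI0 : 0 < I := by positivity
  have hI2 : I ≤ 2 * u ^ 16 := by
    have : (2 : ℝ) ≤ u ^ 16 := by
      calc (2 : ℝ) ≤ 2 ^ 16 := by norm_num
        _ ≤ u ^ 16 := pow_le_pow_left₀ (by norm_num) hu 16
    rw [hI]; linarith
  -- `v = √ℓ ∈ [u, u⁴]`
  set v := Real.sqrt ℓ with hv
  have hv0 : 0 < v := Real.sqrt_pos.mpr hℓ0
  have hv2 : v ^ 2 = ℓ := Real.sq_sqrt hℓ0.le
  have hvlo : u ≤ v := by
    rw [hv, ← Real.sqrt_sq hu0.le]; exact Real.sqrt_le_sqrt hℓlo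
  have hvhi : v ≤ u ^ 4 := by
    rw [hv, ← Real.sqrt_sq (by positivity : (0:ℝ) ≤ u ^ 4)]
    refine Real.sqrt_le_sqrt ?_
    calc ℓ ≤ u ^ 8 := hℓhi
      _ = (u ^ 4) ^ 2 := by ring
  have hv1 : 1 ≤ v := hu1.trans hvlo
  -- square roots
  have hsY : Real.sqrt Y ≤ 3 / 2 * v := by
    rw [← Real.sqrt_sq (by positivity : (0:ℝ) ≤ 3 / 2 * v)]
    exact Real.sqrt_le_sqrt (by nlinarith only [hYhi, hv2, sq_nonneg v])
  have hsY1 : Real.sqrt (Y + 1) ≤ 2 * v := by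
    rw [← Real.sqrt_sq (by positivity : (0:ℝ) ≤ 2 * v)]
    exact Real.sqrt_le_sqrt (by nlinarith only [hYhi, hv2, hv1])
  have hsT : Real.sqrt T' ≤ 2 * v := by
    rw [← Real.sqrt_sq (by positivity : (0:ℝ) ≤ 2 * v)]
    exact Real.sqrt_le_sqrt (by nlinarith only [hT, hv2])
  have hMℓ : M * ℓ ≤ I := by
    have := mul_le_mul_of_nonneg_right hM hℓ0.le
    rwa [div_mul_cancel₀ _ hℓ0.ne'] at this
  have hMv2 : M * v ^ 2 ≤ I := by rw [hv2]; exact hMℓ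
  have hIsq : I ≤ (u ^ 8 + 1) ^ 2 := by
    rw [hI]; nlinarith only [one_le_pow₀ (M₀ := ℝ) (n := 8) hu1]
  have hsM : Real.sqrt M * v ≤ u ^ 8 + 1 := by
    have h1 : Real.sqrt M * v = Real.sqrt (M * v ^ 2) := by
      rw [Real.sqrt_mul hM0, Real.sqrt_sq hv0.le]
    rw [h1, ← Real.sqrt_sq (by positivity : (0:ℝ) ≤ u ^ 8 + 1)]
    exact Real.sqrt_le_sqrt (hMv2.trans hIsq)
  have hsMT : Real.sqrt (M * T') ≤ 2 * (u ^ 8 + 1) := by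
    rw [← Real.sqrt_sq (by positivity : (0:ℝ) ≤ 2 * (u ^ 8 + 1))]
    refine Real.sqrt_le_sqrt ?_
    have h1 : M * T' ≤ M * (4 * ℓ) := mul_le_mul_of_nonneg_left (by linarith) hM0
    nlinarith only [h1, hMℓ, hIsq]
  -- `M ≤ I/u²`, `M v ≤ I/v ≤ I/u`, `1/v ≤ 1/u`
  have hIv : I / v ≤ I / u := div_le_div_of_nonneg_left hI0.le hu0 hvlo
  have hMv : M * v ≤ I / u := by
    have h1 : M * v ≤ I / v := by
      rw [le_div_iff₀ hv0]
      calc M * v * v = M * v ^ 2 := by ring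
        _ ≤ I := hMv2
    exact h1.trans hIv
  have hMu : M ≤ I / u := by
    have h1 : M ≤ M * v := le_mul_of_one_le_right hM0 hv1
    exact h1.trans hMv
  have hIu : I / u ≤ 2 * u ^ 15 := by
    rw [div_le_iff₀ hu0]
    calc I ≤ 2 * u ^ 16 := hI2
      _ = 2 * u ^ 15 * u := by ring
  -- the powers with real exponents
  have h2pow : (2 : ℝ) ^ (22 : ℝ) = 2 ^ 22 := by
    rw [show (22 : ℝ) = ((22 : ℕ) : ℝ) by norm_num, Real.rpow_natCast]
  have hlogpow : Real.log Y ^ (22 : ℝ) = Real.log Y ^ 22 := by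
    rw [show (22 : ℝ) = ((22 : ℕ) : ℝ) by norm_num, Real.rpow_natCast]
  -- the Siegel–Walfisz term: `Y/(log Y)^22 ≤ 2ℓ (8/L)^22`
  have hSW : Y / Real.log Y ^ (22 : ℝ) ≤ 2 * ℓ * (8 ^ 22 / L ^ 22) := by
    rw [hlogpow]
    have h1 : (L / 8) ^ 22 ≤ Real.log Y ^ 22 := pow_le_pow_left₀ (by positivity) hlogY 22
    have h2 : 0 < (L / 8) ^ 22 := by positivity
    calc Y / Real.log Y ^ 22 ≤ Y / (L / 8) ^ 22 := div_le_div_of_nonneg_left hY0.le h2 h1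
      _ ≤ (2 * ℓ) / (L / 8) ^ 22 := div_le_div_of_nonneg_right hYhi h2.le
      _ = 2 * ℓ * (8 ^ 22 / L ^ 22) := by
          field_simp
  -- `S = 7√Y + C₂ 2^22 Y/(log Y)^22`
  have hS : 7 * Real.sqrt Y + C₂ * (2 : ℝ) ^ (22 : ℝ) * Y / Real.log Y ^ (22 : ℝ) ≤
      21 / 2 * v + C₂ * 2 ^ 89 * ℓ / L ^ 22 := by
    rw [h2pow, mul_div_assoc]
    have h1 : C₂ * 2 ^ 22 * (Y / Real.log Y ^ (22 : ℝ)) ≤ C₂ * 2 ^ 22 * (2 * ℓ * (8 ^ 22 / L ^ 22)) :=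
      mul_le_mul_of_nonneg_left hSW (by positivity)
    have h2 : C₂ * 2 ^ 22 * (2 * ℓ * (8 ^ 22 / L ^ 22)) = C₂ * 2 ^ 89 * ℓ / L ^ 22 := by
      rw [show (8 : ℝ) ^ 22 = 2 ^ 66 by norm_num]
      field_simp
    linarith [hsY]
  have hS0 : 0 ≤ 7 * Real.sqrt Y + C₂ * (2 : ℝ) ^ (22 : ℝ) * Y / Real.log Y ^ (22 : ℝ) := by
    have : 0 ≤ Real.log Y ^ (22 : ℝ) := Real.rpow_nonneg hlogY0.le _
    positivity
  -- `M S ≤ (21/2) I/u + C₂ 2^89 I/L^22`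
  have hMS : M * (7 * Real.sqrt Y + C₂ * (2 : ℝ) ^ (22 : ℝ) * Y / Real.log Y ^ (22 : ℝ)) ≤
      21 / 2 * (I / u) + C₂ * 2 ^ 89 * I / L ^ 22 := by
    calc M * (7 * Real.sqrt Y + C₂ * (2 : ℝ) ^ (22 : ℝ) * Y / Real.log Y ^ (22 : ℝ))
        ≤ M * (21 / 2 * v + C₂ * 2 ^ 89 * ℓ / L ^ 22) := mul_le_mul_of_nonneg_left hS hM0
      _ = 21 / 2 * (M * v) + C₂ * 2 ^ 89 * (M * ℓ) / L ^ 22 := by ring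
      _ ≤ 21 / 2 * (I / u) + C₂ * 2 ^ 89 * I / L ^ 22 := by
          gcongr
  -- **the first part** `D₀ M V`
  have hV1 : D₀ * M * (2 * (D₀ * (7 * Real.sqrt Y + C₂ * (2 : ℝ) ^ (22 : ℝ) * Y / Real.log Y ^ (22 : ℝ)) /
      Real.log 2)) ≤ (21 * L ^ 14 * (I / u) + C₂ * 2 ^ 90 * I / L ^ 8) / Real.log 2 := by
    have h1 : D₀ * M * (2 * (D₀ * (7 * Real.sqrt Y + C₂ * (2 : ℝ) ^ (22 : ℝ) * Y / Real.log Y ^ (22 : ℝ)) /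
        Real.log 2)) = 2 * D₀ ^ 2 *
          (M * (7 * Real.sqrt Y + C₂ * (2 : ℝ) ^ (22 : ℝ) * Y / Real.log Y ^ (22 : ℝ))) / Real.log 2 := by
      ring
    rw [h1, div_le_div_iff_of_pos_right hlog2]
    have hD₀sq : D₀ ^ 2 ≤ L ^ 14 := by
      calc D₀ ^ 2 ≤ (L ^ 7) ^ 2 := pow_le_pow_left₀ hD₀0.le hD₀hi 2
        _ = L ^ 14 := by ring
    calc 2 * D₀ ^ 2 * (M * (7 * Real.sqrt Y + C₂ * (2 : ℝ) ^ (22 : ℝ) * Y / Real.log Y ^ (22 : ℝ)))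
        ≤ 2 * L ^ 14 * (21 / 2 * (I / u) + C₂ * 2 ^ 89 * I / L ^ 22) :=
          mul_le_mul (by linarith) hMS (mul_nonneg hM0 hS0) (by positivity)
      _ = 21 * L ^ 14 * (I / u) + C₂ * 2 ^ 90 * I / L ^ 8 := by
          field_simp
  have hV2 : D₀ * M * (2 * (2 * Real.sqrt (Y + 1) * Real.log (Y + 1) / Real.log 2)) ≤
      8 * L ^ 8 * (I / u) / Real.log 2 := by
    have hlogY10 : 0 ≤ Real.log (Y + 1) := Real.log_nonneg (by linarith)
    have h1 : D₀ * M * (2 * (2 * Real.sqrt (Y + 1) * Real.log (Y + 1) / Real.log 2)) =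
        4 * D₀ * (M * Real.sqrt (Y + 1)) * Real.log (Y + 1) / Real.log 2 := by ring
    rw [h1, div_le_div_iff_of_pos_right hlog2]
    have h2 : M * Real.sqrt (Y + 1) ≤ 2 * (I / u) := by
      calc M * Real.sqrt (Y + 1) ≤ M * (2 * v) := mul_le_mul_of_nonneg_left hsY1 hM0
        _ = 2 * (M * v) := by ring
        _ ≤ 2 * (I / u) := by linarith [hMv]
    calc 4 * D₀ * (M * Real.sqrt (Y + 1)) * Real.log (Y + 1)
        ≤ 4 * L ^ 7 * (2 * (I / u)) * L := by
          refine mul_le_mul (mul_le_mul (by linarith) h2 (by positivity) (by positivity)) hlogY1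
            hlogY10 (by positivity)
      _ = 8 * L ^ 8 * (I / u) := by ring
  have hV3 : D₀ * M * (Real.log 1 / Real.log 2) = 0 := by rw [Real.log_one]; ring
  have hV4 : D₀ * M * (Real.log Dn / Real.log 2) ≤ L ^ 8 * (I / u) / Real.log 2 := by
    rw [← mul_div_assoc, div_le_div_iff_of_pos_right hlog2]
    calc D₀ * M * Real.log Dn ≤ L ^ 7 * (I / u) * L :=
          mul_le_mul (mul_le_mul hD₀hi hMu hM0 (by positivity)) hlogDn hlogDn0 (by positivity)
      _ = L ^ 8 * (I / u) := by ring
  have hP1 : D₀ * M *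
      (2 * (D₀ * (7 * Real.sqrt Y + C₂ * (2 : ℝ) ^ (22 : ℝ) * Y / Real.log Y ^ (22 : ℝ)) / Real.log 2 +
          2 * Real.sqrt (Y + 1) * Real.log (Y + 1) / Real.log 2) +
        Real.log 1 / Real.log 2 + Real.log Dn / Real.log 2) ≤
      (60 * L ^ 14 * u ^ 15 + C₂ * 2 ^ 91 * u ^ 16 / L ^ 8) / Real.log 2 := by
    have hexp : D₀ * M *
        (2 * (D₀ * (7 * Real.sqrt Y + C₂ * (2 : ℝ) ^ (22 : ℝ) * Y / Real.log Y ^ (22 : ℝ)) / Real.log 2 +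
            2 * Real.sqrt (Y + 1) * Real.log (Y + 1) / Real.log 2) +
          Real.log 1 / Real.log 2 + Real.log Dn / Real.log 2) =
        D₀ * M * (2 * (D₀ * (7 * Real.sqrt Y + C₂ * (2 : ℝ) ^ (22 : ℝ) * Y / Real.log Y ^ (22 : ℝ)) /
          Real.log 2)) +
        D₀ * M * (2 * (2 * Real.sqrt (Y + 1) * Real.log (Y + 1) / Real.log 2)) +
        D₀ * M * (Real.log 1 / Real.log 2) + D₀ * M * (Real.log Dn / Real.log 2) := by ring
    rw [hexp, hV3]
    have hsum : (21 * L ^ 14 * (I / u) + C₂ * 2 ^ 90 * I / L ^ 8) / Real.log 2 +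
        8 * L ^ 8 * (I / u) / Real.log 2 + 0 + L ^ 8 * (I / u) / Real.log 2 ≤
        (60 * L ^ 14 * u ^ 15 + C₂ * 2 ^ 91 * u ^ 16 / L ^ 8) / Real.log 2 := by
      rw [← add_div, add_zero, ← add_div, div_le_div_iff_of_pos_right hlog2]
      have hL8 : L ^ 8 ≤ L ^ 14 := pow_le_pow_right₀ hL1 (by norm_num)
      have hIu0 : 0 ≤ I / u := by positivity
      have h1 : 21 * L ^ 14 * (I / u) + 8 * L ^ 8 * (I / u) + L ^ 8 * (I / u) ≤ 30 * L ^ 14 * (I / u) := by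
        have := mul_le_mul_of_nonneg_right hL8 hIu0
        linarith
      have h2 : 30 * L ^ 14 * (I / u) ≤ 60 * L ^ 14 * u ^ 15 := by
        have := mul_le_mul_of_nonneg_left hIu (by positivity : (0:ℝ) ≤ 30 * L ^ 14)
        linarith
      have h3 : C₂ * 2 ^ 90 * I / L ^ 8 ≤ C₂ * 2 ^ 91 * u ^ 16 / L ^ 8 := by
        refine div_le_div_of_nonneg_right ?_ (by positivity)
        have := mul_le_mul_of_nonneg_left hI2 (by positivity : (0:ℝ) ≤ C₂ * 2 ^ 90)
        linarith
      linarith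
    linarith [hV1, hV2, hV4, hsum]
  -- **the large-sieve part**
  have hLS1 : 2 * (M + 1) * (T' + 1) / D₀ ≤ 32 * u ^ 16 / L ^ 7 := by
    have h1 : (M + 1) * (T' + 1) ≤ 4 * I + 4 * u ^ 8 := by
      calc (M + 1) * (T' + 1) ≤ (M + 1) * (4 * ℓ) := mul_le_mul_of_nonneg_left hT (by positivity)
        _ = 4 * (M * ℓ) + 4 * ℓ := by ring
        _ ≤ 4 * I + 4 * u ^ 8 := by linarith [hMℓ, hℓhi]
    have h2 : 4 * I + 4 * u ^ 8 ≤ 8 * u ^ 16 := by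
      have h8 : (256 : ℝ) ≤ u ^ 8 := by
        have := pow_le_pow_left₀ (by norm_num : (0:ℝ) ≤ 2) hu 8
        norm_num at this
        exact this
      have h16 : u ^ 16 = u ^ 8 * u ^ 8 := by ring
      have : u ^ 8 + 2 ≤ u ^ 16 := by rw [h16]; nlinarith only [h8]
      rw [hI]; linarith
    rw [div_le_div_iff₀ hD₀0 (by positivity)]
    calc 2 * (M + 1) * (T' + 1) * L ^ 7 = 2 * ((M + 1) * (T' + 1)) * L ^ 7 := by ring
      _ ≤ 2 * (8 * u ^ 16) * L ^ 7 :=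
          mul_le_mul_of_nonneg_right (mul_le_mul_of_nonneg_left (h1.trans h2) (by norm_num))
            (by positivity)
      _ = 32 * u ^ 16 * (L ^ 7 / 2) := by ring
      _ ≤ 32 * u ^ 16 * D₀ := mul_le_mul_of_nonneg_left hD₀lo (by positivity)
  have hLS2 : 2 * (Real.sqrt M * (T' + 1) + Real.sqrt T' * (M + 1)) * (2 + Real.log Dn) ≤
      24 * L * u ^ 15 := by
    have h1 : Real.sqrt M * (T' + 1) ≤ 4 * (u ^ 8 + 1) * u ^ 4 := by
      calc Real.sqrt M * (T' + 1) ≤ Real.sqrt M * (4 * ℓ) :=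
            mul_le_mul_of_nonneg_left hT (Real.sqrt_nonneg _)
        _ = 4 * (Real.sqrt M * v) * v := by rw [← hv2]; ring
        _ ≤ 4 * (u ^ 8 + 1) * u ^ 4 :=
            mul_le_mul (mul_le_mul_of_nonneg_left hsM (by norm_num)) hvhi hv0.le (by positivity)
    have h2 : Real.sqrt T' * (M + 1) ≤ 2 * (I / u) + 2 * u ^ 4 := by
      calc Real.sqrt T' * (M + 1) ≤ 2 * v * (M + 1) := mul_le_mul_of_nonneg_right hsT (by positivity)
        _ = 2 * (M * v) + 2 * v := by ring
        _ ≤ 2 * (I / u) + 2 * u ^ 4 := by linarith [hMv, hvhi]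
    have h3 : 4 * (u ^ 8 + 1) * u ^ 4 + (2 * (I / u) + 2 * u ^ 4) ≤ 6 * u ^ 15 := by
      have h412 : u ^ 4 ≤ u ^ 12 := pow_le_pow_right₀ hu1 (by norm_num)
      have ha : (u ^ 8 + 1) * u ^ 4 ≤ 2 * u ^ 12 := by
        have : (u ^ 8 + 1) * u ^ 4 = u ^ 12 + u ^ 4 := by ring
        rw [this]; linarith
      have hb : 8 * u ^ 12 + 2 * u ^ 4 ≤ 2 * u ^ 15 := by
        have hu3 : (8 : ℝ) ≤ u ^ 3 := by
          have := pow_le_pow_left₀ (by norm_num : (0:ℝ) ≤ 2) hu 3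
          norm_num at this
          exact this
        have h15 : u ^ 15 = u ^ 12 * u ^ 3 := by ring
        have h12 : (0 : ℝ) ≤ u ^ 12 := pow_nonneg hu0.le 12
        have : 8 * u ^ 12 ≤ u ^ 15 := by rw [h15]; nlinarith only [hu3, h12]
        linarith
      linarith [ha, hb, hIu]
    have h4 : 2 + Real.log Dn ≤ 2 * L := by linarith
    calc 2 * (Real.sqrt M * (T' + 1) + Real.sqrt T' * (M + 1)) * (2 + Real.log Dn)
        ≤ 2 * (6 * u ^ 15) * (2 * L) := by
          refine mul_le_mul (mul_le_mul_of_nonneg_left (by linarith) (by norm_num)) h4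
            (by linarith) (by positivity)
      _ = 24 * L * u ^ 15 := by ring
  have hLS3 : 8 * Real.sqrt (M * T') * Dn ≤ 32 * u ^ 8 * (Dx + 1) := by
    calc 8 * Real.sqrt (M * T') * Dn ≤ 8 * (2 * (u ^ 8 + 1)) * (Dx + 1) :=
          mul_le_mul (mul_le_mul_of_nonneg_left hsMT (by norm_num)) hDn hDn0 (by positivity)
      _ ≤ 8 * (2 * (2 * u ^ 8)) * (Dx + 1) := by
          gcongr
          linarith [one_le_pow₀ (M₀ := ℝ) (n := 8) hu1]
      _ = 32 * u ^ 8 * (Dx + 1) := by ring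
  -- nonnegativity of the bracket
  have hP10 : 0 ≤ D₀ * M *
      (2 * (D₀ * (7 * Real.sqrt Y + C₂ * (2 : ℝ) ^ (22 : ℝ) * Y / Real.log Y ^ (22 : ℝ)) / Real.log 2 +
          2 * Real.sqrt (Y + 1) * Real.log (Y + 1) / Real.log 2) +
        Real.log 1 / Real.log 2 + Real.log Dn / Real.log 2) := by
    have : 0 ≤ Real.log (Y + 1) := Real.log_nonneg (by linarith)
    rw [Real.log_one, zero_div, add_zero]
    positivity
  have hLS0 : 0 ≤ 2 * (M + 1) * (T' + 1) / D₀ +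
      2 * (Real.sqrt M * (T' + 1) + Real.sqrt T' * (M + 1)) * (2 + Real.log Dn) +
        8 * Real.sqrt (M * T') * Dn := by positivity
  -- assemble
  have hbr : D₀ * M *
      (2 * (D₀ * (7 * Real.sqrt Y + C₂ * (2 : ℝ) ^ (22 : ℝ) * Y / Real.log Y ^ (22 : ℝ)) / Real.log 2 +
          2 * Real.sqrt (Y + 1) * Real.log (Y + 1) / Real.log 2) +
        Real.log 1 / Real.log 2 + Real.log Dn / Real.log 2) +
      (2 * (M + 1) * (T' + 1) / D₀ +
        2 * (Real.sqrt M * (T' + 1) + Real.sqrt T' * (M + 1)) * (2 + Real.log Dn) +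
          8 * Real.sqrt (M * T') * Dn) ≤
      60 / Real.log 2 * L ^ 14 * u ^ 15 + C₂ * 2 ^ 91 / Real.log 2 * u ^ 16 / L ^ 8 +
        32 * u ^ 16 / L ^ 7 + 24 * L * u ^ 15 + 32 * u ^ 8 * (Dx + 1) := by
    have heq : (60 * L ^ 14 * u ^ 15 + C₂ * 2 ^ 91 * u ^ 16 / L ^ 8) / Real.log 2 =
        60 / Real.log 2 * L ^ 14 * u ^ 15 + C₂ * 2 ^ 91 / Real.log 2 * u ^ 16 / L ^ 8 := by
      field_simp
    linarith [hP1, hLS1, hLS2, hLS3, heq.le, heq.ge]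
  have hG0 : 0 ≤ 60 / Real.log 2 * L ^ 14 * u ^ 15 + C₂ * 2 ^ 91 / Real.log 2 * u ^ 16 / L ^ 8 +
      32 * u ^ 16 / L ^ 7 + 24 * L * u ^ 15 + 32 * u ^ 8 * (Dx + 1) := by positivity
  exact mul_le_mul hW hbr (add_nonneg hP10 hLS0) (by positivity)

/-! ### The parameters of a piece for large `x` -/

/-- `ℓ_k ≤ y` for the pieces that occur (`k < K`), provided `x^{1/8} ≤ y`. [folklore] -/
theorem gridLevel_le_twinY {x : ℕ} {ε : ℝ} (hx : 0 < x) (hε : 0 < ε) {k : ℕ}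
    (hk : k < chenPieceCount x ε) (hzY : (x : ℝ) ^ (1 / 8 : ℝ) ≤ twinY x) :
    gridLevel x ε k ≤ twinY x := by
  unfold gridLevel z
  unfold chenPieceCount at hk
  have hx0 : (0 : ℝ) < x := by exact_mod_cast hx
  have hz0 : 0 < (x : ℝ) ^ (1 / 8 : ℝ) := Real.rpow_pos_of_pos hx0 _
  have hY0 : (0 : ℝ) < twinY x := hz0.trans_le hzY
  have h1ε : (1 : ℝ) < 1 + ε := by linarith
  have hlog1 : 0 < Real.log (1 + ε) := Real.log_pos h1ε
  set q := Real.log ((twinY x : ℝ) / (x : ℝ) ^ (1 / 8 : ℝ)) / Real.log (1 + ε) with hq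
  have hq0 : 0 ≤ q := div_nonneg (Real.log_nonneg (by rwa [le_div_iff₀ hz0, one_mul])) hlog1.le
  have hk' : (k : ℝ) ≤ q := by
    have : k ≤ ⌊q⌋₊ := Nat.lt_succ_iff.mp hk
    exact le_trans (by exact_mod_cast this) (Nat.floor_le hq0)
  have hpow : (1 + ε) ^ k ≤ (twinY x : ℝ) / (x : ℝ) ^ (1 / 8 : ℝ) := by
    rw [← Real.rpow_natCast]
    calc (1 + ε) ^ (k : ℝ) ≤ (1 + ε) ^ q := Real.rpow_le_rpow_of_exponent_le h1ε.le hk'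
      _ = (twinY x : ℝ) / (x : ℝ) ^ (1 / 8 : ℝ) := by
          rw [hq, Real.rpow_def_of_pos (by linarith), mul_div_cancel₀ _ hlog1.ne',
            Real.exp_log (div_pos hY0 hz0)]
  calc (x : ℝ) ^ (1 / 8 : ℝ) * (1 + ε) ^ k ≤ (x : ℝ) ^ (1 / 8 : ℝ) * ((twinY x : ℝ) / (x : ℝ) ^ (1 / 8 : ℝ)) :=
        mul_le_mul_of_nonneg_left hpow hz0.le
    _ = twinY x := mul_div_cancel₀ _ hz0.ne'

/-- `y(x) ≤ x^{1/2}` for `x ≥ 3⁸`: `(x+3)^{1/3} + 1 ≤ (4/3) x^{1/3} + 1 ≤ x^{1/2}` as `x^{1/6} ≥ 3`.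
[folklore] -/
theorem twinY_le_rpow_half {x : ℕ} (hx : 6561 ≤ x) : (twinY x : ℝ) ≤ (x : ℝ) ^ (1 / 2 : ℝ) := by
  have hx1 : (1 : ℝ) ≤ x := by exact_mod_cast (show 1 ≤ x by omega)
  have hx0 : (0 : ℝ) < x := by linarith
  set t : ℝ := (x : ℝ) ^ (1 / 6 : ℝ) with ht
  have ht3 : 3 ≤ t := by
    rw [ht, show (3 : ℝ) = ((3 : ℝ) ^ (6 : ℕ)) ^ (1 / 6 : ℝ) by
      rw [← Real.rpow_natCast, ← Real.rpow_mul (by norm_num)]; norm_num]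
    exact Real.rpow_le_rpow (by norm_num) (by exact_mod_cast (show 729 ≤ x by omega)) (by norm_num)
  have h13 : (x : ℝ) ^ (1 / 3 : ℝ) = t ^ 2 := by
    rw [ht, ← Real.rpow_natCast, ← Real.rpow_mul hx0.le]; norm_num
  have h12 : (x : ℝ) ^ (1 / 2 : ℝ) = t ^ 3 := by
    rw [ht, ← Real.rpow_natCast, ← Real.rpow_mul hx0.le]; norm_num
  -- `(x+3)^{1/3} ≤ (4/3) x^{1/3}`
  have hx' : (6561 : ℝ) ≤ x := by exact_mod_cast hx
  have h1 : ((x : ℝ) + 3) ^ (1 / 3 : ℝ) ≤ 4 / 3 * (x : ℝ) ^ (1 / 3 : ℝ) := by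
    have h2 : ((x : ℝ) + 3) ≤ (64 / 27) * x := by linarith
    calc ((x : ℝ) + 3) ^ (1 / 3 : ℝ) ≤ ((64 / 27) * x) ^ (1 / 3 : ℝ) :=
          Real.rpow_le_rpow (by positivity) h2 (by norm_num)
      _ = 4 / 3 * (x : ℝ) ^ (1 / 3 : ℝ) := by
          rw [Real.mul_rpow (by norm_num) hx0.le,
            show (64 / 27 : ℝ) = (4 / 3 : ℝ) ^ (3 : ℕ) by norm_num, ← Real.rpow_natCast,
            ← Real.rpow_mul (by norm_num)]
          norm_num
  have hy : (twinY x : ℝ) < ((x : ℝ) + 3) ^ (1 / 3 : ℝ) + 1 := Nat.ceil_lt_add_one (by positivity)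
  rw [h13] at h1
  rw [h12]
  nlinarith

/-- The number of pieces is `≤ log x/(2 log(1+ε))` once `log x ≥ 8`, `x ≥ 3⁸` (`y ≤ x^{1/2}`,
`z = x^{1/8}`). [cite: Nathanson1996, Thm 10.6 (proof, (10.12))] -/
theorem chenPieceCount_le {x : ℕ} {ε : ℝ} (hx : 6561 ≤ x) (hε : 0 < ε) (hε1 : ε ≤ 1)
    (hL : 8 ≤ Real.log x) :
    (chenPieceCount x ε : ℝ) ≤ Real.log x / (2 * Real.log (1 + ε)) := by
  unfold chenPieceCount
  have hx1 : (1 : ℝ) < x := by exact_mod_cast (show 1 < x by omega)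
  have hx0 : (0 : ℝ) < x := by linarith
  have hz0 : 0 < (x : ℝ) ^ (1 / 8 : ℝ) := Real.rpow_pos_of_pos hx0 _
  have hzY : (x : ℝ) ^ (1 / 8 : ℝ) ≤ twinY x := by
    calc (x : ℝ) ^ (1 / 8 : ℝ) ≤ (x : ℝ) ^ (1 / 3 : ℝ) :=
          Real.rpow_le_rpow_of_exponent_le hx1.le (by norm_num)
      _ ≤ ((x : ℝ) + 3) ^ (1 / 3 : ℝ) := Real.rpow_le_rpow hx0.le (by linarith) (by norm_num)
      _ ≤ twinY x := Nat.le_ceil _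
  have hY0 : (0 : ℝ) < twinY x := hz0.trans_le hzY
  have h1ε : (1 : ℝ) < 1 + ε := by linarith
  have hlog1 : 0 < Real.log (1 + ε) := Real.log_pos h1ε
  have hlog1' : Real.log (1 + ε) ≤ 1 := by
    have := Real.log_le_sub_one_of_pos (show (0:ℝ) < 1 + ε by linarith)
    linarith
  -- `log(y/z) ≤ (1/2 - 1/8) log x`
  have hratio : Real.log ((twinY x : ℝ) / (x : ℝ) ^ (1 / 8 : ℝ)) ≤ 3 / 8 * Real.log x := by
    rw [Real.log_div hY0.ne' hz0.ne', Real.log_rpow hx0]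
    have h := Real.log_le_log hY0 (twinY_le_rpow_half hx)
    rw [Real.log_rpow hx0] at h
    linarith
  have hq0 : 0 ≤ Real.log ((twinY x : ℝ) / (x : ℝ) ^ (1 / 8 : ℝ)) / Real.log (1 + ε) :=
    div_nonneg (Real.log_nonneg (by rwa [le_div_iff₀ hz0, one_mul])) hlog1.le
  have hfloor : ((⌊Real.log ((twinY x : ℝ) / (x : ℝ) ^ (1 / 8 : ℝ)) / Real.log (1 + ε)⌋₊ : ℕ) : ℝ) ≤
      3 / 8 * Real.log x / Real.log (1 + ε) :=
    (Nat.floor_le hq0).trans (div_le_div_of_nonneg_right hratio hlog1.le)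
  push_cast
  rw [le_div_iff₀ hlog1] at hfloor
  rw [le_div_iff₀ (by positivity)]
  nlinarith [hfloor, hlog1', hL, hlog1]

/-- `x^{1/16}`-bookkeeping: for `x ≥ 1`, `u = x^{1/16}` has `u² = x^{1/8}`, `u⁸ = x^{1/2}`, `u¹⁶ = x`.
[folklore] -/
theorem rpow_sixteenth_pows {x : ℝ} (hx : 0 ≤ x) :
    ((x ^ (1 / 16 : ℝ)) ^ 2 = x ^ (1 / 8 : ℝ)) ∧ ((x ^ (1 / 16 : ℝ)) ^ 8 = x ^ (1 / 2 : ℝ)) ∧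
      ((x ^ (1 / 16 : ℝ)) ^ 16 = x) := by
  refine ⟨?_, ?_, ?_⟩
  · rw [← Real.rpow_natCast, ← Real.rpow_mul hx]; norm_num
  · rw [← Real.rpow_natCast, ← Real.rpow_mul hx]; norm_num
  · rw [← Real.rpow_natCast, ← Real.rpow_mul hx]; norm_num

set_option maxHeartbeats 800000 in
/-- **Thm 10.7 applied to one piece** (Nathanson p. 181–182: `R^{(ℓ)} ≤ ∑_{d<D*} |…| ≪ N/(log N)⁴`):
under the Siegel–Walfisz bound `SWBound 22 C₂`, for `x ≥ 3¹⁶` with `L = log x ≥ 64`, `0 < ε ≤ 1`,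
`δ > 0` and a piece `k < K`, the sum over `d ≤ ⌈x^{1/2−δ}⌉` of the bilinear discrepancies of the
piece is at most the uniform majorant of `piece_explicit_le` (`u = x^{1/16}`, `D₀ = ⌊L⁷⌋`, `A₂ = 22`,
Siegel–Walfisz scale `Y = (1+ε)ℓ_k`). [cite: Nathanson1996, Thm 10.6 (proof, pp. 181–182)] -/
theorem sum_iSup_piece_le {C₂ : ℝ} (hC₂0 : 0 ≤ C₂) (hSW : SWBound 22 C₂) {x : ℕ} {ε δ : ℝ}
    (hε : 0 < ε) (hε1 : ε ≤ 1) (hδ : 0 < δ) (hx : 43046721 ≤ x) (hL : 64 ≤ Real.log x)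
    {k : ℕ} (hk : k < chenPieceCount x ε) :
    ∑ d ∈ Finset.Icc 1 ⌈(x : ℝ) ^ (1 / 2 - δ)⌉₊, ⨆ c : (ZMod d)ˣ,
        ‖(∑ n ∈ Finset.Ioc 0 (chenPieceLen x ε k), ∑ p ∈ chenPiecePrimes x ε k,
            if ((n * p : ℕ) : ZMod d) = c then
              (if n ∈ chenPieceNums x ε k then (1 : ℂ) else 0) else 0) -
          ((Nat.totient d : ℂ))⁻¹ *
            ∑ n ∈ Finset.Ioc 0 (chenPieceLen x ε k), ∑ p ∈ chenPiecePrimes x ε k,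
              (if (n * p).Coprime d then
                (if n ∈ chenPieceNums x ε k then (1 : ℂ) else 0) else 0)‖ ≤
      4 * Real.log x ^ 2 * (60 / Real.log 2 * Real.log x ^ 14 * ((x : ℝ) ^ (1 / 16 : ℝ)) ^ 15 +
        C₂ * 2 ^ 91 / Real.log 2 * ((x : ℝ) ^ (1 / 16 : ℝ)) ^ 16 / Real.log x ^ 8 +
        32 * ((x : ℝ) ^ (1 / 16 : ℝ)) ^ 16 / Real.log x ^ 7 +
        24 * Real.log x * ((x : ℝ) ^ (1 / 16 : ℝ)) ^ 15 +
        32 * ((x : ℝ) ^ (1 / 16 : ℝ)) ^ 8 * ((x : ℝ) ^ (1 / 2 - δ) + 1)) := by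
  have hxpos : 0 < x := by omega
  have hx1 : (1 : ℝ) < x := by exact_mod_cast (show 1 < x by omega)
  have hx0 : (0 : ℝ) < x := by linarith
  have hL0 : 0 < Real.log x := by linarith
  have hL1 : 1 ≤ Real.log x := by linarith
  have hL2 : 2 ≤ Real.log x := by linarith
  -- `u = x^{1/16} ≥ 3`
  set u : ℝ := (x : ℝ) ^ (1 / 16 : ℝ) with hu
  obtain ⟨hu2, hu8, hu16⟩ := rpow_sixteenth_pows hx0.le
  have hu3 : 3 ≤ u := by
    rw [hu, show (3 : ℝ) = ((3 : ℝ) ^ (16 : ℕ)) ^ (1 / 16 : ℝ) by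
      rw [← Real.rpow_natCast, ← Real.rpow_mul (by norm_num)]; norm_num]
    exact Real.rpow_le_rpow (by norm_num) (by exact_mod_cast hx) (by norm_num)
  have hu2' : 2 ≤ u := by linarith
  have hupos : 0 < u := by linarith
  have hlogu : Real.log u = Real.log x / 16 := by rw [hu, Real.log_rpow hx0]; ring
  -- the level `ℓ`
  set ℓ := gridLevel x ε k with hℓ
  have hℓlo : u ^ 2 ≤ ℓ := by rw [hu2]; exact (gridLevel_pos hxpos hε k).2
  have hzY : (x : ℝ) ^ (1 / 8 : ℝ) ≤ twinY x := by
    calc (x : ℝ) ^ (1 / 8 : ℝ) ≤ (x : ℝ) ^ (1 / 3 : ℝ) :=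
          Real.rpow_le_rpow_of_exponent_le hx1.le (by norm_num)
      _ ≤ ((x : ℝ) + 3) ^ (1 / 3 : ℝ) := Real.rpow_le_rpow hx0.le (by linarith) (by norm_num)
      _ ≤ twinY x := Nat.le_ceil _
  have hℓhi : ℓ ≤ u ^ 8 := by
    rw [hu8]
    exact (gridLevel_le_twinY hxpos hε hk hzY).trans (twinY_le_rpow_half (by omega))
  have hℓ9 : 9 ≤ ℓ := le_trans (by nlinarith) hℓlo
  have hℓ0 : 0 < ℓ := by linarith
  have hℓ1 : 1 ≤ ℓ := by linarith
  -- `M`, `T'`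
  set M := chenPieceLen x ε k with hM
  have hM0 : (0 : ℝ) ≤ M := Nat.cast_nonneg _
  have hMle : (M : ℝ) ≤ (u ^ 16 + 2) / ℓ := by
    rw [hM, chenPieceLen, hu16]
    exact Nat.floor_le (by positivity)
  set Hi := chenPieceHi x ε k with hHi
  have hHi : (Hi : ℝ) < (1 + ε) * ℓ + 1 := by
    have h1 : Hi ≤ ⌈(1 + ε) * ℓ⌉₊ := min_le_right _ _
    calc (Hi : ℝ) ≤ ⌈(1 + ε) * ℓ⌉₊ := by exact_mod_cast h1
      _ < (1 + ε) * ℓ + 1 := Nat.ceil_lt_add_one (by positivity)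
  have hT0 : (0 : ℝ) ≤ ((Hi - 1 : ℕ) : ℝ) := Nat.cast_nonneg _
  have hT : ((Hi - 1 : ℕ) : ℝ) + 1 ≤ 4 * ℓ := by
    have h1 : ((Hi - 1 : ℕ) : ℝ) ≤ Hi := by exact_mod_cast Nat.sub_le Hi 1
    nlinarith
  -- `Dn`, `Dx`
  set Dn := ⌈(x : ℝ) ^ (1 / 2 - δ)⌉₊ with hDn
  have hDx : 0 ≤ (x : ℝ) ^ (1 / 2 - δ) := Real.rpow_nonneg hx0.le _
  have hDxpos : 0 < (x : ℝ) ^ (1 / 2 - δ) := Real.rpow_pos_of_pos hx0 _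
  have hDn1 : (1 : ℝ) ≤ Dn := by
    have : 1 ≤ Dn := Nat.one_le_iff_ne_zero.mpr (Nat.pos_iff_ne_zero.mp (Nat.ceil_pos.mpr hDxpos))
    exact_mod_cast this
  have hDnle : (Dn : ℝ) ≤ (x : ℝ) ^ (1 / 2 - δ) + 1 := (Nat.ceil_lt_add_one hDx).le
  have hDxle : (x : ℝ) ^ (1 / 2 - δ) ≤ u ^ 8 := by
    rw [hu8]; exact Real.rpow_le_rpow_of_exponent_le hx1.le (by linarith)
  have hu8big : u ^ 8 + 1 ≤ u ^ 16 := by nlinarith [pow_le_pow_left₀ (by norm_num : (0:ℝ) ≤ 2) hu2' 8]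
  have hlogDn : Real.log Dn ≤ Real.log x := by
    refine Real.log_le_log (by linarith) ?_
    rw [← hu16]; linarith
  -- `D₀ = ⌊L⁷⌋`
  set D₀ : ℕ := ⌊Real.log x ^ 7⌋₊ with hD₀
  have hL7 : (2 : ℝ) ≤ Real.log x ^ 7 := le_trans (by norm_num) (pow_le_pow_left₀ (by norm_num) hL2 7)
  have hD₀hi : (D₀ : ℝ) ≤ Real.log x ^ 7 := Nat.floor_le (by positivity)
  have hD₀lo : Real.log x ^ 7 / 2 ≤ D₀ := by
    have : Real.log x ^ 7 < (D₀ : ℝ) + 1 := Nat.lt_floor_add_one _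
    linarith
  have hD₀1 : 1 ≤ D₀ := Nat.le_floor (by push_cast; linarith)
  -- the Siegel–Walfisz scale `Y = (1+ε)ℓ`
  have hYlo : ℓ ≤ (1 + ε) * ℓ := by nlinarith
  have hYhi : (1 + ε) * ℓ ≤ 2 * ℓ := by nlinarith
  have hY9 : (9 : ℝ) ≤ (1 + ε) * ℓ := hℓ9.trans hYlo
  have hTY : (Hi : ℝ) ≤ (1 + ε) * ℓ + 1 := hHi.le
  have hlogY : Real.log x / 8 ≤ Real.log ((1 + ε) * ℓ) := by
    have h1 : Real.log (u ^ 2) ≤ Real.log ((1 + ε) * ℓ) :=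
      Real.log_le_log (by positivity) (hℓlo.trans hYlo)
    rw [Real.log_pow, hlogu] at h1
    push_cast at h1
    linarith
  have hlogY1 : Real.log ((1 + ε) * ℓ + 1) ≤ Real.log x := by
    refine Real.log_le_log (by positivity) ?_
    rw [← hu16]; nlinarith
  have hD₀Y : (D₀ : ℝ) ≤ (Real.log ((1 + ε) * ℓ) / 2) ^ (22 : ℝ) := by
    rw [show (22 : ℝ) = ((22 : ℕ) : ℝ) by norm_num, Real.rpow_natCast]
    have h1 : Real.log x / 16 ≤ Real.log ((1 + ε) * ℓ) / 2 := by linarith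
    have h2 : (Real.log x / 16) ^ 22 ≤ (Real.log ((1 + ε) * ℓ) / 2) ^ 22 :=
      pow_le_pow_left₀ (by positivity) h1 22
    have h3 : Real.log x ^ 7 ≤ (Real.log x / 16) ^ 22 := by
      have h4 : (64 : ℝ) ^ 15 ≤ Real.log x ^ 15 := pow_le_pow_left₀ (by norm_num) hL 15
      have h5 : (16 : ℝ) ^ 22 ≤ 64 ^ 15 := by norm_num
      rw [div_pow, le_div_iff₀ (by positivity)]
      calc Real.log x ^ 7 * 16 ^ 22 ≤ Real.log x ^ 7 * Real.log x ^ 15 := by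
            exact mul_le_mul_of_nonneg_left (h5.trans h4) (by positivity)
        _ = Real.log x ^ 22 := by ring
    exact hD₀hi.trans (h3.trans h2)
  -- `W`
  have hW : totientInvSum Dn ≤ 4 * Real.log x ^ 2 := by
    refine (totientInvSum_le Dn).trans ?_
    have h1 : 0 ≤ 1 + Real.log Dn := by linarith [Real.log_nonneg hDn1]
    nlinarith [hlogDn, h1]
  -- Theorem 10.7 for the piece
  have hPE := Bilinear.primes_explicit (A₂ := 22) (by norm_num) hC₂0 hSW
    (fun n => if n ∈ chenPieceNums x ε k then (1 : ℂ) else 0) (norm_indicator_le_one _)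
    one_ne_zero M (chenPieceLo x ε k) Hi Dn hD₀1 hY9 hTY hD₀Y
  rw [Nat.cast_one] at hPE
  unfold chenPiecePrimes
  refine hPE.trans ?_
  exact piece_explicit_le hu2' hL2 hℓlo hℓhi hM0 hMle hT0 hT hDn1 hDnle hDx hlogDn hD₀lo hD₀hi
    hYlo hYhi hlogY hlogY1 hC₂0 hW

/-! ### The remainder bound -/

set_option maxHeartbeats 1600000 in
/-- **The remainder bound (step 2 of Nathanson's proof of Thm 10.6)**, hypothesis `hrem` of
`Literature.NumberTheory.Sieve.Chen.twin_sieveUpperB_of`: for `0 < ε ≤ 1`, `δ > 0` and all large `x`,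
`R(x, ε, x^{1/2−δ}) ≤ x/(log x)³` (Nathanson (10.15): `R^{(ℓ)} ≪ N/(log N)⁴` for each of the
`O(ε⁻¹ log N)` pieces, from Thm 10.7 with `A = 7`). Proof: `remainder_term_le` for each modulus,
`sum_iSup_piece_le` (Thm 10.7, `Bilinear.primes_explicit`, with the Siegel–Walfisz theorem
`Literature.NumberTheory.LFunctions.siegel_walfisz_holds` and the large sieve, all PROVED in the tree)
for each piece, the correction `∑_{d ≤ D} ω(d)/φ(d) ≤ (log D/log 2) W(D)`, `W(D) ≤ (1 + log D)²`,
`#N_k ≤ 2x^{7/8}`, `K ≤ log x/(2 log(1+ε))` pieces, and `(log x)^{21} ≤ x^{1/16}`,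
`(log x)⁷ ≤ x^δ` for large `x`. [cite: Nathanson1996, Thm 10.6 (proof, (10.15), pp. 181–182)] -/
theorem chenRemainderExt_bound (ε : ℝ) (hε : 0 < ε) (hε1 : ε ≤ 1) (δ : ℝ) (hδ : 0 < δ) :
    ∃ C : ℝ, ∀ᶠ x : ℕ in atTop,
      chenRemainderExt x ε ((x : ℝ) ^ (1 / 2 - δ)) ≤ C * x / Real.log x ^ 3 := by
  classical
  obtain ⟨C₂, hC₂0, hSW⟩ := swBound_of_siegel_walfisz LFunctions.siegel_walfisz_holds
    (A₂ := 22) (by norm_num)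
  refine ⟨1, ?_⟩
  set a := Real.log (1 + ε) with ha
  have ha0 : 0 < a := Real.log_pos (by linarith)
  have hlog2 : 0 < Real.log 2 := Real.log_pos one_lt_two
  set L₀ : ℝ := max 64 (1300 / (a * Real.log 2) + 20 * C₂ * 2 ^ 91 / (a * Real.log 2) + 1300 / a)
    with hL₀
  have hLev := (Real.tendsto_log_atTop.comp tendsto_natCast_atTop_atTop).eventually_ge_atTop L₀
  have hE1 := tendsto_natCast_atTop_atTop.eventually
    (eventually_log_rpow_le_rpow 21 (s := 1 / 16) (by norm_num))
  have hE2 := tendsto_natCast_atTop_atTop.eventually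
    (eventually_log_rpow_le_rpow 8 (s := 1 / 8) (by norm_num))
  have hE3 := tendsto_natCast_atTop_atTop.eventually (eventually_log_rpow_le_rpow 7 hδ)
  filter_upwards [hLev, hE1, hE2, hE3, eventually_ge_atTop 43046721] with x hLx hE1x hE2x hE3x hx
  -- the largeness facts
  have hL₀x : L₀ ≤ Real.log x := hLx
  have hL64 : 64 ≤ Real.log x := le_trans (le_max_left _ _) hL₀x
  have hLc : 1300 / (a * Real.log 2) + 20 * C₂ * 2 ^ 91 / (a * Real.log 2) + 1300 / a ≤ Real.log x :=
    le_trans (le_max_right _ _) hL₀x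
  have hxpos : 0 < x := by omega
  have hx1 : (1 : ℝ) < x := by exact_mod_cast (show 1 < x by omega)
  have hx0 : (0 : ℝ) < x := by linarith
  set L := Real.log x with hLdef
  have hL0 : 0 < L := by linarith
  have hL1 : 1 ≤ L := by linarith
  have haL1 : 1300 ≤ a * Real.log 2 * L := by
    have h1 : 1300 / (a * Real.log 2) ≤ L := by
      have : 0 ≤ 20 * C₂ * 2 ^ 91 / (a * Real.log 2) := by positivity
      have : 0 ≤ 1300 / a := by positivity
      linarith
    rw [div_le_iff₀ (by positivity)] at h1
    linarith
  have haL2 : 20 * C₂ * 2 ^ 91 ≤ a * Real.log 2 * L := by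
    have h1 : 20 * C₂ * 2 ^ 91 / (a * Real.log 2) ≤ L := by
      have : 0 ≤ 1300 / (a * Real.log 2) := by positivity
      have : 0 ≤ 1300 / a := by positivity
      linarith
    rw [div_le_iff₀ (by positivity)] at h1
    linarith
  have haL3 : 1300 ≤ a * L := by
    have h1 : 1300 / a ≤ L := by
      have : 0 ≤ 1300 / (a * Real.log 2) := by positivity
      have : 0 ≤ 20 * C₂ * 2 ^ 91 / (a * Real.log 2) := by positivity
      linarith
    rw [div_le_iff₀ ha0] at h1
    linarith
  -- `u = x^{1/16}`
  set u : ℝ := (x : ℝ) ^ (1 / 16 : ℝ) with hu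
  obtain ⟨hu2, hu8, hu16⟩ := rpow_sixteenth_pows hx0.le
  have hu3 : 3 ≤ u := by
    rw [hu, show (3 : ℝ) = ((3 : ℝ) ^ (16 : ℕ)) ^ (1 / 16 : ℝ) by
      rw [← Real.rpow_natCast, ← Real.rpow_mul (by norm_num)]; norm_num]
    exact Real.rpow_le_rpow (by norm_num) (by exact_mod_cast hx) (by norm_num)
  have hu1 : 1 ≤ u := by linarith
  have hupos : 0 < u := by linarith
  have hE1' : L ^ 21 ≤ u := by
    have h := hE1x
    rwa [show (21 : ℝ) = ((21 : ℕ) : ℝ) by norm_num, Real.rpow_natCast] at h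
  have hE2' : L ^ 8 ≤ u ^ 2 := by
    have h := hE2x
    rw [show (8 : ℝ) = ((8 : ℕ) : ℝ) by norm_num, Real.rpow_natCast] at h
    rwa [hu2]
  have hE3' : L ^ 7 ≤ (x : ℝ) ^ δ := by
    have h := hE3x
    rwa [show (7 : ℝ) = ((7 : ℕ) : ℝ) by norm_num, Real.rpow_natCast] at h
  -- the objects
  have h3 : 3 ≤ twinZ x := three_le_twinZ (by omega)
  set Dn := ⌈(x : ℝ) ^ (1 / 2 - δ)⌉₊ with hDn
  set Kc := chenPieceCount x ε with hKc
  have hKc : (Kc : ℝ) ≤ L / (2 * a) := chenPieceCount_le (by omega) hε hε1 (by linarith)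
  have hKc0 : (0 : ℝ) ≤ Kc := Nat.cast_nonneg _
  -- abbreviate the two summands of `remainder_term_le`
  set supT : ℕ → ℕ → ℝ := fun d k => ⨆ c : (ZMod d)ˣ,
      ‖(∑ n ∈ Finset.Ioc 0 (chenPieceLen x ε k), ∑ p ∈ chenPiecePrimes x ε k,
          if ((n * p : ℕ) : ZMod d) = c then
            (if n ∈ chenPieceNums x ε k then (1 : ℂ) else 0) else 0) -
        ((Nat.totient d : ℂ))⁻¹ *
          ∑ n ∈ Finset.Ioc 0 (chenPieceLen x ε k), ∑ p ∈ chenPiecePrimes x ε k,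
            (if (n * p).Coprime d then
              (if n ∈ chenPieceNums x ε k then (1 : ℂ) else 0) else 0)‖ with hsupT
  set corT : ℕ → ℕ → ℝ := fun d k =>
    (d.primeFactors.card : ℝ) * #(chenPieceNums x ε k) / Nat.totient d with hcorT
  have hsup0 : ∀ d k, 0 ≤ supT d k := fun d k => Real.iSup_nonneg fun c => norm_nonneg _
  have hcor0 : ∀ d k, 0 ≤ corT d k := fun d k => by rw [hcorT]; positivity
  -- Step 1–2: termwise, and extend the moduli to `[1, Dn]`
  have hstep12 : chenRemainderExt x ε ((x : ℝ) ^ (1 / 2 - δ)) ≤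
      ∑ d ∈ Finset.Icc 1 Dn, ∑ k ∈ Finset.range Kc, (supT d k + corT d k) := by
    unfold chenRemainderExt
    refine le_trans (Finset.sum_le_sum fun d hd => ?_)
      (Finset.sum_le_sum_of_subset_of_nonneg (fun d hd => ?_) fun d _ _ =>
        Finset.sum_nonneg fun k _ => add_nonneg (hsup0 d k) (hcor0 d k))
    · rw [Finset.mem_filter] at hd
      have hd0 : d ≠ 0 := fun h0 => primesProdBelow_ne_zero _ (zero_dvd_iff.mp (h0 ▸ hd.2))
      exact remainder_term_le hxpos hε h3 hd0 hd.2
    · rw [Finset.mem_filter, Finset.mem_range] at hd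
      have hd0 : d ≠ 0 := fun h0 => primesProdBelow_ne_zero _ (zero_dvd_iff.mp (h0 ▸ hd.2))
      rw [Finset.mem_Icc]
      exact ⟨Nat.one_le_iff_ne_zero.mpr hd0, hd.1.le⟩
  -- Step 3: swap the sums
  have hstep3 : ∑ d ∈ Finset.Icc 1 Dn, ∑ k ∈ Finset.range Kc, (supT d k + corT d k) =
      ∑ k ∈ Finset.range Kc, ∑ d ∈ Finset.Icc 1 Dn, supT d k +
        ∑ k ∈ Finset.range Kc, ∑ d ∈ Finset.Icc 1 Dn, corT d k := by
    rw [Finset.sum_comm, ← Finset.sum_add_distrib]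
    refine Finset.sum_congr rfl fun k _ => Finset.sum_add_distrib
  -- Step 4: the bilinear part, piece by piece
  set G : ℝ := 4 * L ^ 2 * (60 / Real.log 2 * L ^ 14 * u ^ 15 + C₂ * 2 ^ 91 / Real.log 2 * u ^ 16 / L ^ 8 +
      32 * u ^ 16 / L ^ 7 + 24 * L * u ^ 15 + 32 * u ^ 8 * ((x : ℝ) ^ (1 / 2 - δ) + 1)) with hG
  have hstep4 : ∑ k ∈ Finset.range Kc, ∑ d ∈ Finset.Icc 1 Dn, supT d k ≤ Kc * G := by
    calc ∑ k ∈ Finset.range Kc, ∑ d ∈ Finset.Icc 1 Dn, supT d k ≤ ∑ k ∈ Finset.range Kc, G :=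
          Finset.sum_le_sum fun k hk =>
            sum_iSup_piece_le hC₂0 hSW hε hε1 hδ hx hL64 (Finset.mem_range.mp hk)
      _ = Kc * G := by rw [Finset.sum_const, Finset.card_range, nsmul_eq_mul]
  -- Step 5: the correction part
  have hNk : ∀ k, (#(chenPieceNums x ε k) : ℝ) ≤ 2 * u ^ 14 := by
    intro k
    have h1 : #(chenPieceNums x ε k) ≤ chenPieceLen x ε k := by
      calc #(chenPieceNums x ε k) ≤ #(Finset.Ioc 0 (chenPieceLen x ε k)) :=
            Finset.card_le_card (chenPieceNums_subset_Ioc hxpos hε k)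
        _ = chenPieceLen x ε k := by simp
    have hℓ : u ^ 2 ≤ gridLevel x ε k := by rw [hu2]; exact (gridLevel_pos hxpos hε k).2
    have hℓ0 : 0 < gridLevel x ε k := lt_of_lt_of_le (by positivity) hℓ
    calc (#(chenPieceNums x ε k) : ℝ) ≤ chenPieceLen x ε k := by exact_mod_cast h1
      _ ≤ ((x : ℝ) + 2) / gridLevel x ε k := Nat.floor_le (by positivity)
      _ ≤ ((x : ℝ) + 2) / u ^ 2 := div_le_div_of_nonneg_left (by positivity) (by positivity) hℓ
      _ ≤ 2 * u ^ 14 := by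
          rw [div_le_iff₀ (by positivity), ← hu16]
          nlinarith [pow_le_pow_left₀ (by norm_num : (0:ℝ) ≤ 2) (by linarith : (2:ℝ) ≤ u) 16]
  have hDx : 0 ≤ (x : ℝ) ^ (1 / 2 - δ) := Real.rpow_nonneg hx0.le _
  have hDxpos : 0 < (x : ℝ) ^ (1 / 2 - δ) := Real.rpow_pos_of_pos hx0 _
  have hDn1 : (1 : ℝ) ≤ Dn := by
    have : 1 ≤ Dn := Nat.one_le_iff_ne_zero.mpr (Nat.pos_iff_ne_zero.mp (Nat.ceil_pos.mpr hDxpos))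
    exact_mod_cast this
  have hu8big : u ^ 8 + 1 ≤ u ^ 16 := by
    nlinarith [pow_le_pow_left₀ (by norm_num : (0:ℝ) ≤ 2) (by linarith : (2:ℝ) ≤ u) 8]
  have hDnle : (Dn : ℝ) ≤ (x : ℝ) ^ (1 / 2 - δ) + 1 := (Nat.ceil_lt_add_one hDx).le
  have hlogDn : Real.log Dn ≤ L := by
    refine Real.log_le_log (by linarith) ?_
    have : (x : ℝ) ^ (1 / 2 - δ) ≤ u ^ 8 := by
      rw [hu8]; exact Real.rpow_le_rpow_of_exponent_le hx1.le (by linarith)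
    rw [← hu16]; linarith
  have hW : totientInvSum Dn ≤ 4 * L ^ 2 := by
    refine (totientInvSum_le Dn).trans ?_
    have h1 : 0 ≤ 1 + Real.log Dn := by linarith [Real.log_nonneg hDn1]
    nlinarith [hlogDn, h1]
  have hstep5 : ∑ k ∈ Finset.range Kc, ∑ d ∈ Finset.Icc 1 Dn, corT d k ≤
      Kc * (8 * L ^ 3 * u ^ 14 / Real.log 2) := by
    have hpiece : ∀ k, ∑ d ∈ Finset.Icc 1 Dn, corT d k ≤ 8 * L ^ 3 * u ^ 14 / Real.log 2 := by
      intro k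
      calc ∑ d ∈ Finset.Icc 1 Dn, corT d k
          ≤ ∑ d ∈ Finset.Icc 1 Dn, (L / Real.log 2 * (2 * u ^ 14)) * ((Nat.totient d : ℝ))⁻¹ := by
            refine Finset.sum_le_sum fun d hd => ?_
            obtain ⟨hd1, hdD⟩ := Finset.mem_Icc.mp hd
            have hd0 : d ≠ 0 := by omega
            have hω : (d.primeFactors.card : ℝ) ≤ L / Real.log 2 := by
              refine (card_primeFactors_le_log_div hd0).trans (div_le_div_of_nonneg_right ?_ hlog2.le)
              exact (Real.log_le_log (by exact_mod_cast Nat.pos_of_ne_zero hd0)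
                (by exact_mod_cast hdD)).trans hlogDn
            rw [hcorT]
            simp only
            rw [div_eq_mul_inv]
            refine mul_le_mul_of_nonneg_right ?_ (inv_nonneg.mpr (Nat.cast_nonneg _))
            exact mul_le_mul hω (hNk k) (Nat.cast_nonneg _) (by positivity)
        _ = L / Real.log 2 * (2 * u ^ 14) * totientInvSum Dn := by
            rw [totientInvSum, Finset.mul_sum]
        _ ≤ L / Real.log 2 * (2 * u ^ 14) * (4 * L ^ 2) :=
            mul_le_mul_of_nonneg_left hW (by positivity)
        _ = 8 * L ^ 3 * u ^ 14 / Real.log 2 := by ring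
    calc ∑ k ∈ Finset.range Kc, ∑ d ∈ Finset.Icc 1 Dn, corT d k
        ≤ ∑ k ∈ Finset.range Kc, 8 * L ^ 3 * u ^ 14 / Real.log 2 := Finset.sum_le_sum fun k _ => hpiece k
      _ = Kc * (8 * L ^ 3 * u ^ 14 / Real.log 2) := by
          rw [Finset.sum_const, Finset.card_range, nsmul_eq_mul]
  -- Step 6: the five terms of `G` and the correction are small
  set Q : ℝ := a * u ^ 16 / (20 * L ^ 6) with hQ
  have hQ' : ∀ X : ℝ, X * (20 * L ^ 6) ≤ a * u ^ 16 → X ≤ Q := fun X h => by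
    rw [hQ, le_div_iff₀ (by positivity)]; exact h
  have h1 : L ^ 21 * u ^ 15 ≤ u ^ 16 := by
    calc L ^ 21 * u ^ 15 ≤ u * u ^ 15 := mul_le_mul_of_nonneg_right hE1' (by positivity)
      _ = u ^ 16 := by ring
  have ht1 : 60 / Real.log 2 * L ^ 14 * u ^ 15 ≤ Q := by
    refine hQ' _ ?_
    have k1 : 1200 / Real.log 2 ≤ a * L := by rw [div_le_iff₀ hlog2]; linarith [haL1]
    calc 60 / Real.log 2 * L ^ 14 * u ^ 15 * (20 * L ^ 6) = 1200 / Real.log 2 * (L ^ 20 * u ^ 15) := by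
          ring
      _ ≤ a * L * (L ^ 20 * u ^ 15) := mul_le_mul_of_nonneg_right k1 (by positivity)
      _ = a * (L ^ 21 * u ^ 15) := by ring
      _ ≤ a * u ^ 16 := mul_le_mul_of_nonneg_left h1 ha0.le
  have ht2 : C₂ * 2 ^ 91 / Real.log 2 * u ^ 16 / L ^ 8 ≤ Q := by
    refine hQ' _ ?_
    have k2 : 20 * C₂ * 2 ^ 91 / Real.log 2 ≤ a * L := by rw [div_le_iff₀ hlog2]; linarith [haL2]
    have k2' : a * L ≤ a * L ^ 2 := mul_le_mul_of_nonneg_left (le_self_pow₀ hL1 (by norm_num)) ha0.le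
    have hL8 : L ^ 8 = L ^ 2 * L ^ 6 := by ring
    calc C₂ * 2 ^ 91 / Real.log 2 * u ^ 16 / L ^ 8 * (20 * L ^ 6) =
        20 * C₂ * 2 ^ 91 / Real.log 2 * u ^ 16 / L ^ 2 := by
          rw [hL8]; field_simp
      _ ≤ a * L ^ 2 * u ^ 16 / L ^ 2 :=
          div_le_div_of_nonneg_right (mul_le_mul_of_nonneg_right (k2.trans k2') (by positivity))
            (by positivity)
      _ = a * u ^ 16 := by field_simp
  have ht3 : 32 * u ^ 16 / L ^ 7 ≤ Q := by
    refine hQ' _ ?_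
    have k3 : 640 / L ≤ a := by rw [div_le_iff₀ hL0]; linarith [haL3]
    have hL7 : L ^ 7 = L * L ^ 6 := by ring
    calc 32 * u ^ 16 / L ^ 7 * (20 * L ^ 6) = 640 / L * u ^ 16 := by
          rw [hL7]
          field_simp
          norm_num
      _ ≤ a * u ^ 16 := mul_le_mul_of_nonneg_right k3 (by positivity)
  have ht4 : 24 * L * u ^ 15 ≤ Q := by
    refine hQ' _ ?_
    have k4 : 480 * L ^ 7 ≤ a * u := by
      have e1 : L ^ 7 ≤ L ^ 20 := pow_le_pow_right₀ hL1 (by norm_num)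
      have e2 : a * L ^ 21 ≤ a * u := mul_le_mul_of_nonneg_left hE1' ha0.le
      have e3 : 1300 * L ^ 20 ≤ a * L ^ 21 := by
        have h := mul_le_mul_of_nonneg_right haL3 (pow_nonneg hL0.le 20)
        calc 1300 * L ^ 20 ≤ a * L * L ^ 20 := h
          _ = a * L ^ 21 := by ring
      have e4 : 480 * L ^ 7 ≤ 480 * L ^ 20 := by linarith
      have e5 : 0 ≤ L ^ 20 := by positivity
      linarith
    calc 24 * L * u ^ 15 * (20 * L ^ 6) = 480 * L ^ 7 * u ^ 15 := by ring
      _ ≤ a * u * u ^ 15 := mul_le_mul_of_nonneg_right k4 (by positivity)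
      _ = a * u ^ 16 := by ring
  have ht5 : 32 * u ^ 8 * ((x : ℝ) ^ (1 / 2 - δ) + 1) ≤ Q := by
    refine hQ' _ ?_
    have hD : (x : ℝ) ^ (1 / 2 - δ) * L ^ 7 ≤ u ^ 8 := by
      have e1 : (x : ℝ) ^ (1 / 2 - δ) * (x : ℝ) ^ δ = u ^ 8 := by
        rw [← Real.rpow_add hx0, hu8]; norm_num
      calc (x : ℝ) ^ (1 / 2 - δ) * L ^ 7 ≤ (x : ℝ) ^ (1 / 2 - δ) * (x : ℝ) ^ δ :=
            mul_le_mul_of_nonneg_left hE3' hDx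
        _ = u ^ 8 := e1
    have hDL : (x : ℝ) ^ (1 / 2 - δ) * L ^ 6 ≤ u ^ 8 / L := by
      rw [le_div_iff₀ hL0]
      calc (x : ℝ) ^ (1 / 2 - δ) * L ^ 6 * L = (x : ℝ) ^ (1 / 2 - δ) * L ^ 7 := by ring
        _ ≤ u ^ 8 := hD
    have k5 : 640 / L ≤ a / 2 := by rw [div_le_iff₀ hL0]; linarith [haL3]
    have p1 : 640 * u ^ 8 * (x : ℝ) ^ (1 / 2 - δ) * L ^ 6 ≤ a / 2 * u ^ 16 := by
      calc 640 * u ^ 8 * (x : ℝ) ^ (1 / 2 - δ) * L ^ 6 = 640 * u ^ 8 * ((x : ℝ) ^ (1 / 2 - δ) * L ^ 6) := by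
            ring
        _ ≤ 640 * u ^ 8 * (u ^ 8 / L) := mul_le_mul_of_nonneg_left hDL (by positivity)
        _ = 640 / L * u ^ 16 := by field_simp
        _ ≤ a / 2 * u ^ 16 := mul_le_mul_of_nonneg_right k5 (by positivity)
    have hp3 : 1280 * L ^ 6 ≤ a * u ^ 8 := by
      have h4 : L ^ 8 ≤ u ^ 8 := hE2'.trans (pow_le_pow_right₀ hu1 (by norm_num))
      have e5 : 1300 * L ^ 7 ≤ a * L ^ 8 := by
        have h := mul_le_mul_of_nonneg_right haL3 (pow_nonneg hL0.le 7)
        calc 1300 * L ^ 7 ≤ a * L * L ^ 7 := h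
          _ = a * L ^ 8 := by ring
      have e6 : L ^ 6 ≤ L ^ 7 := pow_le_pow_right₀ hL1 (by norm_num)
      have e7 : a * L ^ 8 ≤ a * u ^ 8 := mul_le_mul_of_nonneg_left h4 ha0.le
      have e9 : 0 ≤ L ^ 6 := by positivity
      have e8 : 1280 * L ^ 6 ≤ 1300 * L ^ 7 := by linarith
      linarith
    have p2 : 640 * u ^ 8 * L ^ 6 ≤ a / 2 * u ^ 16 := by
      calc 640 * u ^ 8 * L ^ 6 = (1280 * L ^ 6) * u ^ 8 / 2 := by ring
        _ ≤ (a * u ^ 8) * u ^ 8 / 2 :=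
            div_le_div_of_nonneg_right (mul_le_mul_of_nonneg_right hp3 (by positivity)) (by norm_num)
        _ = a / 2 * u ^ 16 := by ring
    calc 32 * u ^ 8 * ((x : ℝ) ^ (1 / 2 - δ) + 1) * (20 * L ^ 6) =
        640 * u ^ 8 * (x : ℝ) ^ (1 / 2 - δ) * L ^ 6 + 640 * u ^ 8 * L ^ 6 := by ring
      _ ≤ a / 2 * u ^ 16 + a / 2 * u ^ 16 := add_le_add p1 p2
      _ = a * u ^ 16 := by ring
  have hG : G ≤ a * u ^ 16 / L ^ 4 := by
    have hsum : 60 / Real.log 2 * L ^ 14 * u ^ 15 + C₂ * 2 ^ 91 / Real.log 2 * u ^ 16 / L ^ 8 +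
        32 * u ^ 16 / L ^ 7 + 24 * L * u ^ 15 + 32 * u ^ 8 * ((x : ℝ) ^ (1 / 2 - δ) + 1) ≤ 5 * Q := by
      linarith
    calc G ≤ 4 * L ^ 2 * (5 * Q) := mul_le_mul_of_nonneg_left hsum (by positivity)
      _ = a * u ^ 16 / L ^ 4 := by
          rw [hQ]
          field_simp
          ring
  have hE6 : 8 * L ^ 3 * u ^ 14 / Real.log 2 ≤ a * u ^ 16 / L ^ 4 := by
    have k6 : 8 * L ^ 7 / Real.log 2 ≤ a * u ^ 2 := by
      have e1 : 8 / Real.log 2 ≤ 16 := by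
        rw [div_le_iff₀ hlog2]; linarith [Real.log_two_gt_d9]
      have e2 : a * L ^ 8 ≤ a * u ^ 2 := mul_le_mul_of_nonneg_left hE2' ha0.le
      have e3 : 1300 * L ^ 7 ≤ a * L ^ 8 := by
        have h := mul_le_mul_of_nonneg_right haL3 (pow_nonneg hL0.le 7)
        calc 1300 * L ^ 7 ≤ a * L * L ^ 7 := h
          _ = a * L ^ 8 := by ring
      calc 8 * L ^ 7 / Real.log 2 = 8 / Real.log 2 * L ^ 7 := by ring
        _ ≤ 16 * L ^ 7 := mul_le_mul_of_nonneg_right e1 (by positivity)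
        _ ≤ a * u ^ 2 := by
            have e4 : 0 ≤ L ^ 7 := by positivity
            linarith
    rw [le_div_iff₀ (by positivity)]
    calc 8 * L ^ 3 * u ^ 14 / Real.log 2 * L ^ 4 = 8 * L ^ 7 / Real.log 2 * u ^ 14 := by ring
      _ ≤ a * u ^ 2 * u ^ 14 := mul_le_mul_of_nonneg_right k6 (by positivity)
      _ = a * u ^ 16 := by ring
  -- Step 7: conclude
  have hfinal : (Kc : ℝ) * G + Kc * (8 * L ^ 3 * u ^ 14 / Real.log 2) ≤ u ^ 16 / L ^ 3 := by
    have h1 : (Kc : ℝ) * G + Kc * (8 * L ^ 3 * u ^ 14 / Real.log 2) ≤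
        L / (2 * a) * (a * u ^ 16 / L ^ 4) + L / (2 * a) * (a * u ^ 16 / L ^ 4) :=
      add_le_add (mul_le_mul hKc hG (by positivity) (by positivity))
        (mul_le_mul hKc hE6 (by positivity) (by positivity))
    have h2 : L / (2 * a) * (a * u ^ 16 / L ^ 4) + L / (2 * a) * (a * u ^ 16 / L ^ 4) =
        u ^ 16 / L ^ 3 := by
      field_simp
      ring
    linarith
  calc chenRemainderExt x ε ((x : ℝ) ^ (1 / 2 - δ))
      ≤ ∑ d ∈ Finset.Icc 1 Dn, ∑ k ∈ Finset.range Kc, (supT d k + corT d k) := hstep12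
    _ = ∑ k ∈ Finset.range Kc, ∑ d ∈ Finset.Icc 1 Dn, supT d k +
          ∑ k ∈ Finset.range Kc, ∑ d ∈ Finset.Icc 1 Dn, corT d k := hstep3
    _ ≤ Kc * G + Kc * (8 * L ^ 3 * u ^ 14 / Real.log 2) := add_le_add hstep4 hstep5
    _ ≤ u ^ 16 / L ^ 3 := hfinal
    _ = 1 * x / Real.log x ^ 3 := by rw [hu16, one_mul]

end Literature.NumberTheory.Sieve.Chen
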